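import Summits.ValiantsHypothesis.ValiantsHypothesis.Theses.BorderApolarity
import Literature.Computability.AlgebraicComplexity.Apolarity
import Literature.Computability.AlgebraicComplexity.BorderDcQuadraticBoundProofs
import Literature.Computability.AlgebraicComplexity.OrbitClosureProofs
import Literature.Computability.AlgebraicComplexity.PermanentVsDeterminantProofs
import Literature.Computability.AlgebraicComplexity.DeterminantalComplexityProofs
import Literature.Computability.AlgebraicComplexity.StandardFamiliesProofs
import Mathlib.Algebra.MvPolynomial.PDeriv

/-!
# Disproof work file for crux `FixedWitnessObstructionQP` (stmt-ValiantsHypothesis-5778)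

Standing adversary (cdisprove), generation 2.  Route `BorderApolarity`, decl
`Summit.ValiantsHypothesis.ValiantsHypothesis.Theses.BorderApolarity.FixedWitnessObstructionQP` (= X).

**PROVENANCE NOTE.** Generation 1 (refuter-cdisprove-stmt-ValiantsHypothesis-5778-0, 2026-08-15)
attached a 62 KB `Disproof.lean` as item evidence only (`run/gate/evidence/…`), a store that is NOT
readable from seats on the compute-free hub and was never published under `Cruxes/`; its text is lost
to later generations.  This file is a from-scratch reconstruction of its load-bearing content plus the
generation-2 findings, and it IS published (`ledger crux write … Disproof.lean`).  Gen-1 results that are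
only summarised (not re-proved) here are marked `[gen1-summary]`.

## Findings (index)

* §0 `IsWitness`, `WitnessExists`, `crux_iff` (`Iff.rfl`): X ↔ ∀ c ∃ n₀ ∀ n ≥ n₀ ∀ m in the window,
  ¬ WitnessExists n m.  `borel_iff`, `wtm_iff`: the two support items in the same vocabulary.
* §1 THE SANDWICH.  `gctWindow_of_crux` (needs `BorelFixedBorderApolarity`) and `crux_of_gctWindow`
  (needs `WitnessToMembership` — PROVED in §7, so see §8 for the unconditional forms):
  **X is pointwise equivalent to the quasi-polynomial Mulmuley–Sohoni thesis `GctWindow`**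
  (`crux_iff_gctWindow`).  CONSEQUENCE FOR DISPROOF: ¬X ⟹ ¬GctWindow, i.e. a refutation of X is a
  quasi-polynomial upper bound on the BORDER determinantal complexity of infinitely many permanents —
  out of reach; X resists every cheap attack for the same reason the MS conjecture does.
* §2 SLICES that are theorems: `crux_slice_zero` (c = 0, empty window, unconditional) and
  `crux_slice_one` (c = 1: m ≤ 2n is killed by LMR13 `n² ≤ 2m`, proved in tree as
  `LMR2013_thm_1_1_1_holds`; needs only `WitnessToMembership`).  The content of X starts at c = 2.
* §3 LOAD-BEARING HYPOTHESES of the witness notion (W1 orbit, W2 liminf, W3 limsup, W4 H₀, W5 apolar):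
  `false_without_limsup` (drop W3 ⟹ J ≡ {0} is a junk witness everywhere, X-variant FALSE);
  `false_without_orbit` (drop W1 ⟹ fat-point junk witness, FALSE);
  W2 and W4 carry NO weight in the direction X ⟸ GctWindow (`crux_of_gctWindow` never uses them):
  they are free normal-form hypotheses a prover MAY use, consistent by Borel — not constraints that
  could make X vacuous.
* §4 THRESHOLDS / REFUTED STRENGTHENINGS (Grenet `dc(per_n) ≤ 2ⁿ − 1` + Valiant universality + MS
  Prop 4.4, all proved in tree ⟹ `pp_mem_orbitClosure_of_pow_le`): unconditionally
  `not_gctWindow_exp` (the exponential window m ≤ 2ⁿ is FALSE for GctWindow) and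
  `gctWindow_threshold_gt` (any valid n₀(c) satisfies n₀(2) ≥ 65, n₀(3) ≥ 2745 — instances
  `gctWindow_threshold_two/three`; by the same lemma n₀(4) ≥ 194482 = (17+4)⁴ + 1, n₀(c) ≳ (c log₂ c)^c);
  given Borel the same for X
  (`not_crux_expWindow`, `crux_threshold_gt`).  Any proof of X must use the quasi-polynomial shape
  of the window and cannot start below n = 65 even at c = 2.
* §3b `witnessExists_one`, `crux_threshold_ge_two`: the honest witness at (1,1) — every threshold is ≥ 2,
  unconditionally.
* §6 COMPUTATIONS (see `FixedWitnessComputations.md` / `FixedWitnessScript.md` in this directory): explicit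
  H₀(n,m)-fixed witnesses by an effective Borel procedure at (2,3),(2,4),(3,7) [per] and (2,3),(3,4),(3,5),(3,7)
  [padded det twin], all verified; low degrees are per-blind (V₂ ⊇ S²U, V₃ ⊇ S³U at (3,7)), witnesses are
  ~monomial; a numerical search for border expressions of ℓ^{m−3}per_3 with m ≤ 6 (kit jobs, see NOTES) is
  the only computational path to evidence against the mechanism.
* §7 `WTM.witnessToMembership_holds : WitnessToMembership` — the support item stmt-5782 PROVED here
  (sorry-free, axioms propext/choice/Quot.sound; W2, W4 and `3 ≤ n` unused): top-degree pairing
  `apolarAction_eq_C`, sup-sphere compactness, corrected annihilators `mem_of_L_eq_zero`,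
  proportionality `exists_smul_of_ker_le`, cone-stability `smul_mem_glOrbit_detPoly` (row scaling),
  Euclidean ⊆ Zariski `mem_orbitClosure_of_tendsto`.  A prover can land it verbatim for stmt-5782.
* §8 UNCONDITIONAL COROLLARIES: `crux_of_gctThesis : GctWindow → X`; `crux_iff_gctWindow'` (needs only
  Borel); `crux_slice_one'`; `mem_of_witnessExists`; `not_witnessExists_of_lt` (LMR: no witness when
  2m < n²), `not_witnessExists_three_four`.

* §9 `Bilin.*` — THE BASIC APOLARITY API the route's items and cards assume (absent from
  `Literature/…/Apolarity.lean`): bilinearity (`apolarAction_add_left/right`, `_smul_`, `_sum_`, `_sub_`),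
  `apolarAction_C`, `apolarAction_X : Xᵢ ⌟ g = pderiv i g`, the DERIVATIVE RULE `apolarAction_X_mul`,
  MULTIPLICATIVITY `apolarAction_mul : (D₁D₂) ⌟ f = D₁ ⌟ (D₂ ⌟ f)` (k[∂]-module), the chain rule
  `pderiv_linSubst`, **GL-EQUIVARIANCE `apolarAction_linSubst : D ⌟ (A·f) = A·((Aᵀ·D) ⌟ f)`** for every
  matrix `A` and `apolarAction_linSubst_eq_zero_iff` (`Ann(A·f) = {D : Aᵀ D ∈ Ann f}` for invertible A —
  the transport rule behind W4), `coeff_apolarAction_X`, `eq_zero_of_forall_apolarAction_X` (Euler-type),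
  `apolarAction_isHomogeneous`, `apolar_all_of_top` (for a border limit, W5 in degree m gives all);
  TORUS facts `linSubst_torusDiag_detPoly : det(aᵢbⱼx_ij) = Πa Πb · det`, `apolarAction_torusDiag_detPoly`
  (Ann(det) is torus-stable); CLOSEDNESS `mem_annihilatorOfDegree_of_tendsto` (Ann_j(f) is closed under
  coefficientwise limits — the W3 clause for constant sequences), `coeff_apolarAction_eq_sum_deg`.
* §11 `isH0Stable_ann_detPoly` (H₀(m,m) = rank-one torus; Ann(det_m) is H₀(m,m)-stable), `junkWitness_det`,
  `false_without_apolar`: W5 is load-bearing.  LOAD-BEARING TABLE: W1 ✓ (§3), W2 free (§8), W3 ✓ (§3),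
  W4 free (§10), W5 ✓ (§11).
* §10 `witnessExists_iff_top`, `crux_iff_top`: **the apolarity clause W5 carries exactly ONE hyperplane
  condition** (`J_m ⊆ pp^⊥_m`); every lower-degree condition `J_k ⊆ pp^⊥_k` is automatic.  So the whole
  per-content of a witness is `lim [P_t] = [pp]`; everything else in X is Z_det-membership + H₀-fixedness
  (this is what the cards' "Partials(pp) ⊆ V_k" laws reduce to).  `CruxWithoutH0`,
  `cruxWithoutH0_of_gctThesis`, `crux_of_cruxWithoutH0`: W4 is logically free —
  GctWindow ⟹ (X without W4) ⟹ X, unconditionally.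

Nothing in this file refutes X.  VERDICT (cycle 2): X resists because X ⟸ GctWindow is a THEOREM (§8):
refuting X means exhibiting border-determinantal expressions of size 2^{O((log n)^c)} for infinitely many
padded permanents.
-/

namespace Summit.ValiantsHypothesis.ValiantsHypothesis.Cruxes.FixedWitnessObstructionQP.Disproof

open Literature.Computability.AlgebraicComplexity
open Summit.ValiantsHypothesis.ValiantsHypothesis.Theses.BorderApolarity
open Filter
open scoped Matrix BigOperators

set_option linter.dupNamespace false

noncomputable section

/-! ## §0 Vocabulary -/

/-- `rk` weight used by the crux to order the variables (ℓ = (0,0) and the Y-block first). -/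
def rk (n m : ℕ) [NeZero m] (p : Fin m × Fin m) : ℕ :=
  (if (m - n ≤ (p.1 : ℕ) ∧ m - n ≤ (p.2 : ℕ)) ∨ p = (0, 0) then 0 else m * m) + ((p.1 : ℕ) * m + (p.2 : ℕ))

/-- W4 of the crux: stability of `J` under `D ↦ linSubst Mᵀ D` for every `M ∈ H₀(n,m)`, verbatim. -/
def IsH0Stable (n m : ℕ) [NeZero m] (J : ℕ → Set (MvPolynomial (Fin m × Fin m) ℂ)) : Prop :=
  ∀ A : Matrix.GeneralLinearGroup (Fin m × Fin m) ℂ,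
    let M : Matrix (Fin m × Fin m) (Fin m × Fin m) ℂ := A
    (∀ i j : Fin m × Fin m, M j i ≠ 0 → rk n m j ≤ rk n m i) →
    (∀ i j : Fin m × Fin m, ((m - n ≤ (i.1 : ℕ) ∧ m - n ≤ (i.2 : ℕ)) ∨ i = (0, 0)) → j ≠ i → M j i = 0) →
    (∀ i k j l : Fin m, m - n ≤ (i : ℕ) → m - n ≤ (k : ℕ) → m - n ≤ (j : ℕ) → m - n ≤ (l : ℕ) →
      M (i, j) (i, j) * M (k, l) (k, l) = M (i, l) (i, l) * M (k, j) (k, j)) →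
    M (0, 0) (0, 0) ^ (m - n) * ∏ i ∈ Finset.univ.filter (fun i : Fin m => m - n ≤ (i : ℕ)), M (i, i) (i, i) = 1 →
    ∀ k ≤ m, ∀ D ∈ J k, linSubst (Fin m × Fin m) ℂ Mᵀ D ∈ J k

/-- W5: apolarity to the padded permanent in degrees `≤ m`. -/
def IsApolarPP (n m : ℕ) [NeZero m] (J : ℕ → Set (MvPolynomial (Fin m × Fin m) ℂ)) : Prop :=
  ∀ k ≤ m, ∀ D ∈ J k, apolarAction D (paddedPerPoly ℂ n m) = 0

/-- W2 (liminf clause) for a general sequence `P`. -/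
def IsLiminf (m : ℕ) (P : ℕ → MvPolynomial (Fin m × Fin m) ℂ)
    (J : ℕ → Set (MvPolynomial (Fin m × Fin m) ℂ)) : Prop :=
  ∀ k ≤ m, ∀ D ∈ J k, ∃ Ds : ℕ → MvPolynomial (Fin m × Fin m) ℂ,
      (∀ t, (Ds t).IsHomogeneous k ∧ apolarAction (Ds t) (P t) = 0) ∧
        Tendsto (fun t => coeffVec (Ds t)) atTop (nhds (coeffVec D))

/-- W3 (limsup clause) for a general sequence `P`. -/
def IsLimsup (m : ℕ) (P : ℕ → MvPolynomial (Fin m × Fin m) ℂ)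
    (J : ℕ → Set (MvPolynomial (Fin m × Fin m) ℂ)) : Prop :=
  ∀ k ≤ m, ∀ (D : MvPolynomial (Fin m × Fin m) ℂ) (φ : ℕ → ℕ) (Ds : ℕ → MvPolynomial (Fin m × Fin m) ℂ),
      StrictMono φ → (∀ t, (Ds t).IsHomogeneous k ∧ apolarAction (Ds t) (P (φ t)) = 0) →
        Tendsto (fun t => coeffVec (Ds t)) atTop (nhds (coeffVec D)) → D ∈ J k

/-- W1: the sequence stays in the orbit `GL_{m²} · det_m`. -/
def InOrbit (m : ℕ) (P : ℕ → MvPolynomial (Fin m × Fin m) ℂ) : Prop :=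
  ∀ t : ℕ, P t ∈ glOrbit (Fin m × Fin m) ℂ (detPoly (Fin m) ℂ)

/-- The witness predicate W1 ∧ W2 ∧ W3 ∧ W4 ∧ W5 of the crux (same nesting, `act ↦ apolarAction`). -/
def IsWitness (n m : ℕ) [NeZero m] (P : ℕ → MvPolynomial (Fin m × Fin m) ℂ)
    (J : ℕ → Set (MvPolynomial (Fin m × Fin m) ℂ)) : Prop :=
  InOrbit m P ∧ IsLiminf m P J ∧ IsLimsup m P J ∧ IsH0Stable n m J ∧ IsApolarPP n m J

/-- A Borel-fixed border-apolar witness exists at `(n, m)`. -/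
def WitnessExists (n m : ℕ) [NeZero m] : Prop :=
  ∃ (P : ℕ → MvPolynomial (Fin m × Fin m) ℂ) (J : ℕ → Set (MvPolynomial (Fin m × Fin m) ℂ)), IsWitness n m P J

/-- W2 ∧ W3 is `IsBorderApolarLimit m P J` of `Literature/…/Apolarity.lean`. [folklore] -/
theorem isLiminf_and_isLimsup_iff {m : ℕ} (P : ℕ → MvPolynomial (Fin m × Fin m) ℂ)
    (J : ℕ → Set (MvPolynomial (Fin m × Fin m) ℂ)) :
    (IsLiminf m P J ∧ IsLimsup m P J) ↔ IsBorderApolarLimit m P J := Iff.rfl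

/-- **X unfolded** (by `Iff.rfl`): the crux says that beyond a threshold `n₀(c)` no witness exists in
the window `n ≤ m ≤ 2^((log₂ n + c)^c)`. [folklore] -/
theorem crux_iff :
    FixedWitnessObstructionQP ↔
      ∀ c : ℕ, ∃ n₀ : ℕ, ∀ n ≥ n₀, ∀ (m : ℕ) [NeZero m], n ≤ m → m ≤ 2 ^ ((Nat.log 2 n + c) ^ c) →
        ¬ WitnessExists n m :=
  Iff.rfl

/-- Support item `BorelFixedBorderApolarity` (stmt-5781) unfolded. [folklore] -/
theorem borel_iff :
    BorelFixedBorderApolarity ↔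
      ∀ (n m : ℕ) [NeZero m], 3 ≤ n → n ≤ m →
        paddedPerPoly ℂ n m ∈ orbitClosure (detPoly (Fin m) ℂ) → WitnessExists n m :=
  Iff.rfl

/-- Support item `WitnessToMembership` (stmt-5782) unfolded. [folklore] -/
theorem wtm_iff :
    WitnessToMembership ↔
      ∀ (n m : ℕ) [NeZero m], 3 ≤ n → n ≤ m →
        WitnessExists n m → paddedPerPoly ℂ n m ∈ orbitClosure (detPoly (Fin m) ℂ) :=
  Iff.rfl

/-! ## §1 The sandwich: X versus the quasi-polynomial Mulmuley–Sohoni thesis -/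

/-- The quasi-polynomial Mulmuley–Sohoni thesis in the window form used by the route
(= hypothesis of `GctBridge` = `GCTMult.GctThesis`). -/
def GctWindow : Prop :=
  ∀ c : ℕ, ∃ n₀ : ℕ, ∀ n ≥ n₀, ∀ (m : ℕ) [NeZero m], n ≤ m → m ≤ 2 ^ ((Nat.log 2 n + c) ^ c) →
    paddedPerPoly ℂ n m ∉ orbitClosure (detPoly (Fin m) ℂ)

/-- `GctBridge` is literally `GctWindow → VH`. [folklore] -/
theorem gctBridge_iff : GctBridge ↔ (GctWindow → _root_.ValiantsHypothesis) := Iff.rfl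

/-- X ⟹ GctWindow given the Borel-fixed border apolarity support item (the route's assembly step).
[folklore] -/
theorem gctWindow_of_crux (hB : BorelFixedBorderApolarity) (hX : FixedWitnessObstructionQP) :
    GctWindow := by
  intro c
  obtain ⟨n₀, hn₀⟩ := crux_iff.1 hX c
  refine ⟨max n₀ 3, fun n hn m _ hnm hm hmem => ?_⟩
  have h3 : 3 ≤ n := le_trans (le_max_right _ _) hn
  exact hn₀ n (le_trans (le_max_left _ _) hn) m hnm hm ((borel_iff.1 hB) n m h3 hnm hmem)

/-- **GctWindow ⟹ X** given only the elementary converse `WitnessToMembership` (proved sorry-free by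
gen 1, attached to stmt-5782 as `WTM.lean`; it uses W1, W3 and W5 in degree `m` only).  Hence any
refutation of X refutes the quasi-polynomial Mulmuley–Sohoni thesis. [folklore] -/
theorem crux_of_gctWindow (hW : WitnessToMembership) (hG : GctWindow) : FixedWitnessObstructionQP := by
  rw [crux_iff]
  intro c
  obtain ⟨n₀, hn₀⟩ := hG c
  refine ⟨max n₀ 3, fun n hn m _ hnm hm hw => ?_⟩
  have h3 : 3 ≤ n := le_trans (le_max_right _ _) hn
  exact hn₀ n (le_trans (le_max_left _ _) hn) m hnm hm ((wtm_iff.1 hW) n m h3 hnm hw)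

/-- **X ⟺ GctWindow** given both support items: the crux is the MS thesis in normal form.
[folklore] -/
theorem crux_iff_gctWindow (hB : BorelFixedBorderApolarity) (hW : WitnessToMembership) :
    FixedWitnessObstructionQP ↔ GctWindow :=
  ⟨gctWindow_of_crux hB, crux_of_gctWindow hW⟩

/-! ## §2 Slices of X that are theorems -/

/-- The `c = 0` slice of X holds vacuously: the window `n ≤ m ≤ 2^((log₂ n)^0) = 2` is empty for
`n ≥ 3`. [folklore] -/
theorem crux_slice_zero :
    ∃ n₀ : ℕ, ∀ n ≥ n₀, ∀ (m : ℕ) [NeZero m], n ≤ m → m ≤ 2 ^ ((Nat.log 2 n + 0) ^ 0) →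
      ¬ WitnessExists n m := by
  refine ⟨3, fun n hn m _ hnm hm _ => ?_⟩
  simp only [pow_zero, pow_one] at hm
  omega

/-- The `c = 1` slice of X (window `m ≤ 2^(log₂ n + 1) ≤ 2n`) follows from LMR13 `n² ≤ 2m`
(`LMR2013_thm_1_1_1_holds`, proved in tree) and `WitnessToMembership` alone: n₀ = 5 works.
[cite: LandsbergManivelRessayre2013, Theorem 1.1.1] -/
theorem crux_slice_one (hW : WitnessToMembership) :
    ∃ n₀ : ℕ, ∀ n ≥ n₀, ∀ (m : ℕ) [NeZero m], n ≤ m → m ≤ 2 ^ ((Nat.log 2 n + 1) ^ 1) →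
      ¬ WitnessExists n m := by
  refine ⟨5, fun n hn m _ hnm hm hw => ?_⟩
  have hmem := (wtm_iff.1 hW) n m (by omega) hnm hw
  have hlmr : n ^ 2 ≤ 2 * m := LMR2013_thm_1_1_1_holds n m hnm hmem
  have hlog : 2 ^ Nat.log 2 n ≤ n := Nat.pow_log_le_self 2 (by omega)
  have hpow : 2 ^ ((Nat.log 2 n + 1) ^ 1) = 2 ^ Nat.log 2 n * 2 := by
    rw [pow_one, pow_succ]
  have hm' : m ≤ 2 * n := by
    rw [hpow] at hm
    omega
  nlinarith

/-! ## §3 Load-bearing hypotheses of the witness notion -/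

/-- X with the limsup clause W3 dropped from the witness notion. -/
def CruxWithoutLimsup : Prop :=
  ∀ c : ℕ, ∃ n₀ : ℕ, ∀ n ≥ n₀, ∀ (m : ℕ) [NeZero m], n ≤ m → m ≤ 2 ^ ((Nat.log 2 n + c) ^ c) →
    ¬ ∃ (P : ℕ → MvPolynomial (Fin m × Fin m) ℂ) (J : ℕ → Set (MvPolynomial (Fin m × Fin m) ℂ)),
      InOrbit m P ∧ IsLiminf m P J ∧ IsH0Stable n m J ∧ IsApolarPP n m J

/-- The zero family `J ≡ {0}` with the constant sequence `det_m` satisfies W1, W2, W4, W5 at every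
`(n, m)`: without W3 the witness notion is junk. [folklore] -/
theorem junkWitness_zero (n m : ℕ) [NeZero m] :
    InOrbit m (fun _ => detPoly (Fin m) ℂ) ∧ IsLiminf m (fun _ => detPoly (Fin m) ℂ) (fun _ => {0}) ∧
      IsH0Stable n m (fun _ => {0}) ∧ IsApolarPP n m (fun _ => {0}) := by
  refine ⟨fun _ => mem_glOrbit_self _, ?_, ?_, ?_⟩
  · intro k _ D hD
    rw [Set.mem_singleton_iff] at hD
    subst hD
    exact ⟨fun _ => 0, fun _ => ⟨MvPolynomial.isHomogeneous_zero _ _ _, apolarAction_zero_left _⟩,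
      tendsto_const_nhds⟩
  · intro A M _ _ _ _ k _ D hD
    rw [Set.mem_singleton_iff] at hD ⊢
    subst hD
    exact map_zero _
  · intro k _ D hD
    rw [Set.mem_singleton_iff] at hD
    subst hD
    exact apolarAction_zero_left _

/-- **W3 (limsup) is load-bearing**: `CruxWithoutLimsup` is FALSE — at `c = 1`, `m = n` is in the
window and the zero family is a junk witness. Any proof of X must use W3. [folklore] -/
theorem false_without_limsup : ¬ CruxWithoutLimsup := by
  intro h
  obtain ⟨n₀, hn₀⟩ := h 1
  have hn : max n₀ 1 ≥ n₀ := le_max_left _ _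
  haveI : NeZero (max n₀ 1) := ⟨by omega⟩
  refine hn₀ (max n₀ 1) hn (max n₀ 1) le_rfl ?_ ⟨_, _, junkWitness_zero (max n₀ 1) (max n₀ 1)⟩
  simp only [pow_one]
  exact le_of_lt (Nat.lt_pow_succ_log_self (by norm_num) _)

/-- Coefficient extraction for the apolarity action on a single monomial `x^{d₀}`: if every exponent
of `D` is `≤ d₀` then the coefficient of `x^{d₀ - e}` in `D ⌟ x^{d₀}` is `D_e · ∏ descFactorial`.
[folklore] -/
theorem coeff_apolarAction_monomial_one {σ : Type*} [DecidableEq σ] (D : MvPolynomial σ ℂ)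
    (d₀ e : σ →₀ ℕ) (hD : ∀ e' ∈ D.support, e' ≤ d₀) (he : e ≤ d₀) :
    MvPolynomial.coeff (d₀ - e) (apolarAction D (MvPolynomial.monomial d₀ (1 : ℂ))) =
      MvPolynomial.coeff e D * ∏ i ∈ e.support, (Nat.descFactorial (d₀ i) (e i) : ℂ) := by
  classical
  rw [apolarAction_def, MvPolynomial.support_monomial, if_neg one_ne_zero]
  simp only [Finset.sum_singleton, MvPolynomial.coeff_monomial, MvPolynomial.coeff_sum]
  rw [Finset.sum_eq_single e]
  · simp
  · intro e' he' hne
    rw [if_neg]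
    intro hEq
    apply hne
    have h1 := hD e' he'
    ext i
    have hi := congrArg (fun f : σ →₀ ℕ => f i) hEq
    simp only [Finsupp.coe_tsub, Pi.sub_apply] at hi
    have h1i : e' i ≤ d₀ i := h1 i
    have h2i : e i ≤ d₀ i := he i
    omega
  · intro hne
    rw [MvPolynomial.notMem_support_iff] at hne
    simp [hne]

/-- A `D` all of whose exponents are `≤ d₀` and with `D ⌟ x^{d₀} = 0` vanishes. [folklore] -/
theorem eq_zero_of_apolarAction_monomial_one {σ : Type*} [DecidableEq σ] {D : MvPolynomial σ ℂ}
    {d₀ : σ →₀ ℕ} (hD : ∀ e ∈ D.support, e ≤ d₀)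
    (h : apolarAction D (MvPolynomial.monomial d₀ (1 : ℂ)) = 0) : D = 0 := by
  classical
  by_contra hne
  obtain ⟨e, he⟩ := MvPolynomial.ne_zero_iff.1 hne
  have hes : e ∈ D.support := MvPolynomial.mem_support_iff.2 he
  have hle := hD e hes
  have hc := coeff_apolarAction_monomial_one D d₀ e hD hle
  rw [h, MvPolynomial.coeff_zero] at hc
  have hprod : (∏ i ∈ e.support, (Nat.descFactorial (d₀ i) (e i) : ℂ)) ≠ 0 := by
    rw [Finset.prod_ne_zero_iff]
    intro i _
    have : Nat.descFactorial (d₀ i) (e i) ≠ 0 :=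
      fun h0 => (not_lt.2 (hle i)) (Nat.descFactorial_eq_zero_iff_lt.1 h0)
    exact_mod_cast this
  exact he ((mul_eq_zero.1 hc.symm).resolve_right hprod)

/-- The fat-point exponent `(m, …, m)` on the `m²` variables. -/
def fatExp (m : ℕ) : (Fin m × Fin m) →₀ ℕ := Finsupp.equivFunOnFinite.symm (fun _ => m)

@[simp] theorem fatExp_apply (m : ℕ) (i : Fin m × Fin m) : fatExp m i = m := by
  simp [fatExp]

/-- The fat point `x^{(m,…,m)}` has NO annihilators of degree `≤ m`: a homogeneous `D` of degree
`k ≤ m` with `D ⌟ x^{(m,…,m)} = 0` is zero. [folklore] -/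
theorem eq_zero_of_apolar_fat {m k : ℕ} (hk : k ≤ m) {D : MvPolynomial (Fin m × Fin m) ℂ}
    (hD : D.IsHomogeneous k) (h : apolarAction D (MvPolynomial.monomial (fatExp m) (1 : ℂ)) = 0) :
    D = 0 := by
  classical
  refine eq_zero_of_apolarAction_monomial_one (fun e he => ?_) h
  have hdeg : e.degree = k := by
    rw [Finsupp.degree_eq_weight_one]
    exact hD (MvPolynomial.mem_support_iff.1 he)
  exact Finsupp.le_def.2 fun i => by
    rw [fatExp_apply]
    exact le_trans (le_trans (Finsupp.le_degree i e) hdeg.le) hk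

/-- X with the orbit clause W1 dropped from the witness notion. -/
def CruxWithoutOrbit : Prop :=
  ∀ c : ℕ, ∃ n₀ : ℕ, ∀ n ≥ n₀, ∀ (m : ℕ) [NeZero m], n ≤ m → m ≤ 2 ^ ((Nat.log 2 n + c) ^ c) →
    ¬ ∃ (P : ℕ → MvPolynomial (Fin m × Fin m) ℂ) (J : ℕ → Set (MvPolynomial (Fin m × Fin m) ℂ)),
      IsLiminf m P J ∧ IsLimsup m P J ∧ IsH0Stable n m J ∧ IsApolarPP n m J

/-- The fat point (constant sequence) with `J ≡ {0}` satisfies W2–W5 at every `(n, m)`: W3 holds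
because `Ann_{≤ m}(x^{(m,…,m)}) = 0`. So W1 is load-bearing — but only through "points of
`GL·det_m` have MANY low-degree annihilators" (`codim Ann_k = C(m,k)²`), not through `P_t ≠ 0`.
[folklore] -/
theorem junkWitness_fat (n m : ℕ) [NeZero m] :
    IsLiminf m (fun _ => MvPolynomial.monomial (fatExp m) (1 : ℂ)) (fun _ => {0}) ∧
    IsLimsup m (fun _ => MvPolynomial.monomial (fatExp m) (1 : ℂ)) (fun _ => {0}) ∧
      IsH0Stable n m (fun _ => {0}) ∧ IsApolarPP n m (fun _ => {0}) := by
  obtain ⟨_, _, h4, h5⟩ := junkWitness_zero n m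
  refine ⟨?_, ?_, h4, h5⟩
  · intro k _ D hD
    rw [Set.mem_singleton_iff] at hD
    subst hD
    exact ⟨fun _ => 0, fun _ => ⟨MvPolynomial.isHomogeneous_zero _ _ _, apolarAction_zero_left _⟩,
      tendsto_const_nhds⟩
  · intro k hk D φ Ds _ hDs hlim
    rw [Set.mem_singleton_iff]
    have h0 : ∀ t, Ds t = 0 := fun t => eq_zero_of_apolar_fat hk (hDs t).1 (hDs t).2
    have hconst : (fun t => coeffVec (Ds t)) = fun _ => coeffVec (0 : MvPolynomial (Fin m × Fin m) ℂ) :=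
      funext fun t => by rw [h0 t]
    rw [hconst] at hlim
    exact coeffVec_injective (tendsto_nhds_unique tendsto_const_nhds hlim).symm

/-- **W1 (orbit) is load-bearing**: `CruxWithoutOrbit` is FALSE (fat-point junk witness at `m = n`,
`c = 1`). [folklore] -/
theorem false_without_orbit : ¬ CruxWithoutOrbit := by
  intro h
  obtain ⟨n₀, hn₀⟩ := h 1
  have hn : max n₀ 1 ≥ n₀ := le_max_left _ _
  haveI : NeZero (max n₀ 1) := ⟨by omega⟩
  refine hn₀ (max n₀ 1) hn (max n₀ 1) le_rfl ?_ ⟨_, _, junkWitness_fat (max n₀ 1) (max n₀ 1)⟩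
  simp only [pow_one]
  exact le_of_lt (Nat.lt_pow_succ_log_self (by norm_num) _)

/-! ## §3b The smallest honest witness: `(n, m) = (1, 1)`, so every threshold is `≥ 2` -/

/-- `det_1 = X₀₀ = x^{fatExp 1}`. [folklore] -/
theorem detPoly_fin_one : detPoly (Fin 1) ℂ = MvPolynomial.monomial (fatExp 1) (1 : ℂ) := by
  have hfat : fatExp 1 = Finsupp.single ((0 : Fin 1), (0 : Fin 1)) 1 := by
    ext i
    rw [fatExp_apply, Subsingleton.elim i ((0 : Fin 1), (0 : Fin 1)), Finsupp.single_eq_same]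
  rw [detPoly, Matrix.det_unique, hfat]
  rfl

/-- **`WitnessExists n 1` for every `n`** (honest witness: the constant sequence `det_1 = X₀₀ = per_1`,
`J ≡ {0}`, and `Ann_{≤1}(X₀₀) = 0` makes W3 true). In the window only `n ≤ 1` matters. [folklore] -/
theorem witnessExists_one (n : ℕ) : WitnessExists n 1 := by
  refine ⟨fun _ => MvPolynomial.monomial (fatExp 1) (1 : ℂ), fun _ => {0}, ?_, junkWitness_fat n 1⟩
  intro t
  rw [← detPoly_fin_one]
  exact mem_glOrbit_self _

/-- **Unconditional tightness: every valid threshold of every slice satisfies `n₀ ≥ 2`** (`m = n = 1`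
lies in every window and carries a witness). [gen1-summary: `threshold_ge_two`; re-proved] [folklore] -/
theorem crux_threshold_ge_two {c n₀ : ℕ}
    (h : ∀ n ≥ n₀, ∀ (m : ℕ) [NeZero m], n ≤ m → m ≤ 2 ^ ((Nat.log 2 n + c) ^ c) → ¬ WitnessExists n m) :
    2 ≤ n₀ := by
  by_contra hlt
  push Not at hlt
  exact h 1 (by omega) 1 le_rfl Nat.one_le_two_pow (witnessExists_one 1)

/-! ## §4 Thresholds and refuted strengthenings (Grenet + Valiant universality + MS Prop 4.4) -/

/-- Grenet: `per_n` has an affine determinantal representation of size `2ⁿ − 1` (in tree: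
`determinantalComplexity_perPoly_le_holds` + attainment of `dc`). [cite: Grenet2011, Theorem 1] -/
theorem hasDetRepr_perPoly_grenet (n : ℕ) (hn : 1 ≤ n) :
    HasDetRepr (perPoly (Fin n) ℂ) (2 ^ n - 1) :=
  HasDetRepr.mono_holds (hasDetRepr_determinantalComplexity_holds _)
    (determinantalComplexity_perPoly_le_holds ℂ n hn)

/-- For `m ≥ 2ⁿ − 1` (and `n ≥ 1`) the padded permanent lies in `Δ(det_m)` — unconditional, from
proved tree facts. [cite: Grenet2011, Theorem 1] -/
theorem pp_mem_orbitClosure_of_pow_le {n m : ℕ} [NeZero m] (hn : 1 ≤ n) (hm : 2 ^ n - 1 ≤ m) :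
    paddedPerPoly ℂ n m ∈ orbitClosure (detPoly (Fin m) ℂ) := by
  have h1 : HasDetRepr (perPoly (Fin n) ℂ) m := HasDetRepr.mono_holds (hasDetRepr_perPoly_grenet n hn) hm
  have hnm : n ≤ m := le_trans (Nat.le_sub_one_of_lt Nat.lt_two_pow_self) hm
  exact paddedPerPoly_mem_orbitClosure_detPoly_of_hasDetRepr_holds h1 hnm

/-- **The exponential window is false for GctWindow** (unconditional): for every `n₀` some `n ≥ n₀`
has `pp ∈ Δ(det_m)` with `n ≤ m ≤ 2ⁿ` (namely `m = 2ⁿ − 1`). Any proof must use the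
quasi-polynomial shape of the window. [cite: Grenet2011, Theorem 1] -/
theorem not_gctWindow_exp :
    ¬ ∃ n₀ : ℕ, ∀ n ≥ n₀, ∀ (m : ℕ) [NeZero m], n ≤ m → m ≤ 2 ^ n →
      paddedPerPoly ℂ n m ∉ orbitClosure (detPoly (Fin m) ℂ) := by
  rintro ⟨n₀, h⟩
  set n := max n₀ 1 with hn
  have hn1 : 1 ≤ n := le_max_right _ _
  have h2 : 2 ≤ 2 ^ n := by
    calc (2 : ℕ) = 2 ^ 1 := by norm_num
      _ ≤ 2 ^ n := Nat.pow_le_pow_right (by norm_num) hn1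
  haveI : NeZero (2 ^ n - 1) := ⟨by omega⟩
  exact h n (le_max_left _ _) (2 ^ n - 1) (Nat.le_sub_one_of_lt Nat.lt_two_pow_self) (Nat.sub_le _ _)
    (pp_mem_orbitClosure_of_pow_le hn1 le_rfl)

/-- **Threshold lower bound for GctWindow** (unconditional): if `N ≥ 1` and `2^N − 1` lies in the
`c`-window of `N`, then every valid threshold `n₀` of the `c`-slice exceeds `N`.
[cite: Grenet2011, Theorem 1] -/
theorem gctWindow_threshold_gt {c n₀ N : ℕ} (hN1 : 1 ≤ N)
    (hN : 2 ^ N - 1 ≤ 2 ^ ((Nat.log 2 N + c) ^ c))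
    (h : ∀ n ≥ n₀, ∀ (m : ℕ) [NeZero m], n ≤ m → m ≤ 2 ^ ((Nat.log 2 n + c) ^ c) →
      paddedPerPoly ℂ n m ∉ orbitClosure (detPoly (Fin m) ℂ)) : N < n₀ := by
  by_contra hle
  push Not at hle
  have h2 : 2 ≤ 2 ^ N := by
    calc (2 : ℕ) = 2 ^ 1 := by norm_num
      _ ≤ 2 ^ N := Nat.pow_le_pow_right (by norm_num) hN1
  haveI : NeZero (2 ^ N - 1) := ⟨by omega⟩
  exact h N hle (2 ^ N - 1) (Nat.le_sub_one_of_lt Nat.lt_two_pow_self) hN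
    (pp_mem_orbitClosure_of_pow_le hN1 le_rfl)

/-- `log₂ 64 = 6`. [folklore] -/
theorem log_two_64 : Nat.log 2 64 = 6 := by
  rw [show (64 : ℕ) = 2 ^ 6 by norm_num, Nat.log_pow (by norm_num)]

/-- `log₂ 2744 = 11`. [folklore] -/
theorem log_two_2744 : Nat.log 2 2744 = 11 := by
  rw [Nat.log_eq_iff (Or.inl (by norm_num))]
  norm_num

/-- **n₀(2) ≥ 65 for GctWindow**, unconditionally: at `c = 2` the instance `n = 64`,
`m = 2⁶⁴ − 1 ≤ 2^((6+2)²)` is a Grenet membership inside the window. [cite: Grenet2011, Theorem 1] -/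
theorem gctWindow_threshold_two {n₀ : ℕ}
    (h : ∀ n ≥ n₀, ∀ (m : ℕ) [NeZero m], n ≤ m → m ≤ 2 ^ ((Nat.log 2 n + 2) ^ 2) →
      paddedPerPoly ℂ n m ∉ orbitClosure (detPoly (Fin m) ℂ)) : 64 < n₀ :=
  gctWindow_threshold_gt (c := 2) (by norm_num) (by rw [log_two_64]; norm_num) h

/-- **n₀(3) ≥ 2745 for GctWindow**, unconditionally (`(11 + 3)³ = 2744`). [cite: Grenet2011, Theorem 1] -/
theorem gctWindow_threshold_three {n₀ : ℕ}
    (h : ∀ n ≥ n₀, ∀ (m : ℕ) [NeZero m], n ≤ m → m ≤ 2 ^ ((Nat.log 2 n + 3) ^ 3) →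
      paddedPerPoly ℂ n m ∉ orbitClosure (detPoly (Fin m) ℂ)) : 2744 < n₀ :=
  gctWindow_threshold_gt (c := 3) (by norm_num) (by rw [log_two_2744]; norm_num) h

/-- Given Borel-fixed border apolarity, Grenet memberships are witnesses: `WitnessExists n m` for all
`3 ≤ n`, `2ⁿ − 1 ≤ m`. [cite: Grenet2011, Theorem 1] -/
theorem witnessExists_of_pow_le (hB : BorelFixedBorderApolarity) {n m : ℕ} [NeZero m] (h3 : 3 ≤ n)
    (hm : 2 ^ n - 1 ≤ m) : WitnessExists n m :=
  (borel_iff.1 hB) n m h3 (le_trans (Nat.le_sub_one_of_lt Nat.lt_two_pow_self) hm)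
    (pp_mem_orbitClosure_of_pow_le (by omega) hm)

/-- **Refuted strengthening (given Borel): X with the exponential window `m ≤ 2ⁿ` is FALSE.**
[cite: Grenet2011, Theorem 1] -/
theorem not_crux_expWindow (hB : BorelFixedBorderApolarity) :
    ¬ ∃ n₀ : ℕ, ∀ n ≥ n₀, ∀ (m : ℕ) [NeZero m], n ≤ m → m ≤ 2 ^ n → ¬ WitnessExists n m := by
  rintro ⟨n₀, h⟩
  set n := max n₀ 3 with hn
  have hn3 : 3 ≤ n := le_max_right _ _
  have h2 : 2 ≤ 2 ^ n := by
    calc (2 : ℕ) = 2 ^ 1 := by norm_num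
      _ ≤ 2 ^ n := Nat.pow_le_pow_right (by norm_num) (by omega)
  haveI : NeZero (2 ^ n - 1) := ⟨by omega⟩
  exact h n (le_max_left _ _) (2 ^ n - 1) (Nat.le_sub_one_of_lt Nat.lt_two_pow_self) (Nat.sub_le _ _)
    (witnessExists_of_pow_le hB hn3 le_rfl)

/-- **Refuted strengthening (given Borel): "no witness at all for large n" is FALSE** — for every
`n ≥ 3` there are witnesses at all `m ≥ 2ⁿ − 1`. [cite: Grenet2011, Theorem 1] -/
theorem not_crux_allM (hB : BorelFixedBorderApolarity) :
    ¬ ∃ n₀ : ℕ, ∀ n ≥ n₀, ∀ (m : ℕ) [NeZero m], n ≤ m → ¬ WitnessExists n m := by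
  rintro ⟨n₀, h⟩
  exact not_crux_expWindow hB ⟨n₀, fun n hn m _ hnm _ => h n hn m hnm⟩

/-- **Threshold lower bound for X (given Borel)**: as `gctWindow_threshold_gt`. [cite: Grenet2011, Theorem 1] -/
theorem crux_threshold_gt (hB : BorelFixedBorderApolarity) {c n₀ N : ℕ} (hN3 : 3 ≤ N)
    (hN : 2 ^ N - 1 ≤ 2 ^ ((Nat.log 2 N + c) ^ c))
    (h : ∀ n ≥ n₀, ∀ (m : ℕ) [NeZero m], n ≤ m → m ≤ 2 ^ ((Nat.log 2 n + c) ^ c) →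
      ¬ WitnessExists n m) : N < n₀ := by
  by_contra hle
  push Not at hle
  have h2 : 2 ≤ 2 ^ N := by
    calc (2 : ℕ) = 2 ^ 1 := by norm_num
      _ ≤ 2 ^ N := Nat.pow_le_pow_right (by norm_num) (by omega)
  haveI : NeZero (2 ^ N - 1) := ⟨by omega⟩
  exact h N hle (2 ^ N - 1) (Nat.le_sub_one_of_lt Nat.lt_two_pow_self) hN
    (witnessExists_of_pow_le hB hN3 le_rfl)

/-- n₀(2) ≥ 65 for X, given Borel. [cite: Grenet2011, Theorem 1] -/
theorem crux_threshold_two (hB : BorelFixedBorderApolarity) {n₀ : ℕ}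
    (h : ∀ n ≥ n₀, ∀ (m : ℕ) [NeZero m], n ≤ m → m ≤ 2 ^ ((Nat.log 2 n + 2) ^ 2) →
      ¬ WitnessExists n m) : 64 < n₀ :=
  crux_threshold_gt hB (c := 2) (by norm_num) (by rw [log_two_64]; norm_num) h

/-- n₀(3) ≥ 2745 for X, given Borel. [cite: Grenet2011, Theorem 1] -/
theorem crux_threshold_three (hB : BorelFixedBorderApolarity) {n₀ : ℕ}
    (h : ∀ n ≥ n₀, ∀ (m : ℕ) [NeZero m], n ≤ m → m ≤ 2 ^ ((Nat.log 2 n + 3) ^ 3) →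
      ¬ WitnessExists n m) : 2744 < n₀ :=
  crux_threshold_gt hB (c := 3) (by norm_num) (by rw [log_two_2744]; norm_num) h

end

end Summit.ValiantsHypothesis.ValiantsHypothesis.Cruxes.FixedWitnessObstructionQP.Disproof

/-! ## §7 WitnessToMembership (stmt-5782) PROVED — makes §1's `crux_of_gctWindow` unconditional -/

namespace Summit.ValiantsHypothesis.ValiantsHypothesis.Cruxes.FixedWitnessObstructionQP.Disproof.WTM

open Literature.Computability.AlgebraicComplexity
open Summit.ValiantsHypothesis.ValiantsHypothesis.Theses.BorderApolarity
open Filter MvPolynomial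
open scoped Matrix BigOperators Topology ComplexConjugate

set_option linter.dupNamespace false
set_option linter.unusedSectionVars false

noncomputable section

variable {σ : Type*}

/-! ## 1. The top-degree pairing -/

/-- `d! := ∏_{i ∈ supp d} (d i)!` as a complex number. -/
def fact (d : σ →₀ ℕ) : ℂ := ∏ i ∈ d.support, ((d i).factorial : ℂ)

theorem fact_ne_zero (d : σ →₀ ℕ) : fact d ≠ 0 := by
  unfold fact
  rw [Finset.prod_ne_zero_iff]
  intro i _
  exact_mod_cast (d i).factorial_ne_zero

/-- Two exponents of the same degree with `e ≤ d` are equal. -/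
theorem eq_of_le_of_degree_eq {e d : σ →₀ ℕ} (h : e ≤ d) (hdeg : e.degree = d.degree) : e = d := by
  have h1 : e + (d - e) = d := add_tsub_cancel_of_le h
  have h2 : (d - e).degree = 0 := by
    have := congrArg Finsupp.degree h1
    rw [map_add] at this
    omega
  rw [Finsupp.degree_eq_zero_iff] at h2
  rw [h2, add_zero] at h1
  exact h1

/-- **Top-degree pairing.** For `D, g` homogeneous of the same degree `m`,
`D ⌟ g = C (Σ_{d ∈ supp D} D_d g_d d!)`. [folklore] -/
theorem apolarAction_eq_C [DecidableEq σ] {D g : MvPolynomial σ ℂ} {m : ℕ}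
    (hD : D.IsHomogeneous m) (hg : g.IsHomogeneous m) :
    apolarAction D g = C (∑ d ∈ D.support, coeff d D * coeff d g * fact d) := by
  classical
  rw [apolarAction_def, map_sum]
  refine Finset.sum_congr rfl fun e he => ?_
  have hedeg : e.degree = m := by
    rw [Finsupp.degree_eq_weight_one]; exact hD (mem_support_iff.1 he)
  -- inner sum collapses to the `d = e` term
  rw [Finset.sum_eq_single e]
  · -- d = e
    have hprod : (∏ i ∈ e.support, (Nat.descFactorial (e i) (e i) : ℂ)) = fact e := by
      unfold fact
      refine Finset.prod_congr rfl fun i _ => ?_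
      rw [Nat.descFactorial_self]
    rw [tsub_self, hprod]
    rfl
  · intro d hd hne
    have hddeg : d.degree = m := by
      rw [Finsupp.degree_eq_weight_one]; exact hg (mem_support_iff.1 hd)
    have hnle : ¬ e ≤ d := fun hle => hne (eq_of_le_of_degree_eq hle (hedeg.trans hddeg.symm)).symm
    obtain ⟨i, hi⟩ : ∃ i, d i < e i := by
      by_contra hcon
      push Not at hcon
      exact hnle fun i => hcon i
    have hie : i ∈ e.support := by
      rw [Finsupp.mem_support_iff]; omega
    have hzero : (Nat.descFactorial (d i) (e i) : ℂ) = 0 := by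
      rw [Nat.descFactorial_eq_zero_iff_lt.2 hi, Nat.cast_zero]
    rw [Finset.prod_eq_zero hie hzero, mul_zero, map_zero]
  · intro hne
    rw [notMem_support_iff] at hne
    rw [hne, mul_zero, zero_mul, map_zero]

/-! ## 2. Degree-`m` exponents as a finite type, coefficient functionals -/

section Fin

variable [Fintype σ] [DecidableEq σ]

/-- The degree-`m` exponents form a finite type. -/
instance fintypeDeg (m : ℕ) : Fintype {d : σ →₀ ℕ // d.degree = m} :=
  Fintype.subtype ((Finset.univ : Finset σ).finsuppAntidiag m) fun d => by
    simp [Finset.mem_finsuppAntidiag, Finsupp.degree_eq_sum]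

/-- The linear functional `L_w(D) = Σ_{|d| = m} D_d w_d`. -/
def L (m : ℕ) (w : {d : σ →₀ ℕ // d.degree = m} → ℂ) (D : MvPolynomial σ ℂ) : ℂ :=
  ∑ d : {d : σ →₀ ℕ // d.degree = m}, coeff d.1 D * w d

/-- The weighted coefficient vector `d ↦ g_d · d!` of `g` in degree `m`. -/
def wvec (m : ℕ) (g : MvPolynomial σ ℂ) : {d : σ →₀ ℕ // d.degree = m} → ℂ :=
  fun d => coeff d.1 g * fact d.1

/-- A sum over the support of a degree-`m` form is a sum over all degree-`m` exponents. -/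
theorem sum_support_eq_sum_deg {m : ℕ} {D : MvPolynomial σ ℂ} (hD : D.IsHomogeneous m)
    (F : (σ →₀ ℕ) → ℂ) (hF : ∀ d, coeff d D = 0 → F d = 0) :
    ∑ d ∈ D.support, F d = ∑ d : {d : σ →₀ ℕ // d.degree = m}, F d.1 := by
  classical
  have hsub : D.support ⊆ (Finset.univ : Finset σ).finsuppAntidiag m := by
    intro d hd
    have : d.degree = m := by
      rw [Finsupp.degree_eq_weight_one]; exact hD (mem_support_iff.1 hd)
    simp [Finset.mem_finsuppAntidiag, Finsupp.degree_eq_sum, ← this]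
  rw [Finset.sum_subset hsub (fun d _ hd => hF d (notMem_support_iff.1 hd))]
  rw [← Finset.sum_subtype ((Finset.univ : Finset σ).finsuppAntidiag m)]
  intro d
  simp [Finset.mem_finsuppAntidiag, Finsupp.degree_eq_sum]

/-- Pairing in functional form: `D ⌟ g = C (L_{wvec g} D)` for forms of degree `m`. -/
theorem apolarAction_eq_C_L {D g : MvPolynomial σ ℂ} {m : ℕ}
    (hD : D.IsHomogeneous m) (hg : g.IsHomogeneous m) :
    apolarAction D g = C (L m (wvec m g) D) := by
  rw [apolarAction_eq_C hD hg]
  congr 1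
  unfold L wvec
  rw [sum_support_eq_sum_deg hD (fun d => coeff d D * coeff d g * fact d)
    (fun d hd => by rw [hd, zero_mul, zero_mul])]
  refine Finset.sum_congr rfl fun d _ => ?_
  ring

/-- Hence `D ∈ Ann_m(g)` iff `L_{wvec g}(D) = 0`, for forms of degree `m`. -/
theorem apolarAction_eq_zero_iff {D g : MvPolynomial σ ℂ} {m : ℕ}
    (hD : D.IsHomogeneous m) (hg : g.IsHomogeneous m) :
    apolarAction D g = 0 ↔ L m (wvec m g) D = 0 := by
  rw [apolarAction_eq_C_L hD hg]
  exact ⟨fun h => by simpa using congrArg (coeff 0) h, fun h => by rw [h, map_zero]⟩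

theorem L_smul_left {m : ℕ} (c : ℂ) (w : {d : σ →₀ ℕ // d.degree = m} → ℂ) (D : MvPolynomial σ ℂ) :
    L m (c • w) D = c * L m w D := by
  unfold L
  rw [Finset.mul_sum]
  refine Finset.sum_congr rfl fun d _ => ?_
  simp only [Pi.smul_apply, smul_eq_mul]
  ring

theorem L_smul_poly {m : ℕ} (c : ℂ) (w : {d : σ →₀ ℕ // d.degree = m} → ℂ) (D : MvPolynomial σ ℂ) :
    L m w (c • D) = c * L m w D := by
  unfold L
  rw [Finset.mul_sum]
  refine Finset.sum_congr rfl fun d _ => ?_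
  rw [coeff_smul, smul_eq_mul]
  ring

theorem L_sub_poly {m : ℕ} (w : {d : σ →₀ ℕ // d.degree = m} → ℂ) (D E : MvPolynomial σ ℂ) :
    L m w (D - E) = L m w D - L m w E := by
  unfold L
  rw [← Finset.sum_sub_distrib]
  refine Finset.sum_congr rfl fun d _ => ?_
  rw [coeff_sub]
  ring

/-- `L_w(D)` is continuous in `w`. -/
theorem continuous_L {m : ℕ} (D : MvPolynomial σ ℂ) :
    Continuous fun w : {d : σ →₀ ℕ // d.degree = m} → ℂ => L m w D := by
  unfold L
  exact continuous_finsetSum _ fun d _ => continuous_const.mul (continuous_apply d)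

/-- The polynomial with prescribed degree-`m` coefficient vector `c`. -/
def polyOf (m : ℕ) (c : {d : σ →₀ ℕ // d.degree = m} → ℂ) : MvPolynomial σ ℂ :=
  ∑ d : {d : σ →₀ ℕ // d.degree = m}, monomial d.1 (c d)

theorem coeff_polyOf (m : ℕ) (c : {d : σ →₀ ℕ // d.degree = m} → ℂ) (d : {d : σ →₀ ℕ // d.degree = m}) :
    coeff d.1 (polyOf m c) = c d := by
  classical
  unfold polyOf
  rw [coeff_sum, Finset.sum_eq_single d]
  · rw [coeff_monomial, if_pos rfl]
  · intro e _ hne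
    rw [coeff_monomial, if_neg]
    exact fun h => hne (Subtype.ext h)
  · intro h; exact absurd (Finset.mem_univ d) h

theorem polyOf_isHomogeneous (m : ℕ) (c : {d : σ →₀ ℕ // d.degree = m} → ℂ) :
    (polyOf m c).IsHomogeneous m := by
  unfold polyOf
  refine IsHomogeneous.sum _ _ _ fun d _ => ?_
  exact isHomogeneous_monomial _ d.2

theorem L_polyOf (m : ℕ) (w c : {d : σ →₀ ℕ // d.degree = m} → ℂ) :
    L m w (polyOf m c) = ∑ d, c d * w d := by
  unfold L
  refine Finset.sum_congr rfl fun d _ => ?_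
  rw [coeff_polyOf]

/-- A nonzero form of degree `m` has a nonzero weighted vector. -/
theorem wvec_ne_zero {m : ℕ} {g : MvPolynomial σ ℂ} (hg : g.IsHomogeneous m) (hne : g ≠ 0) :
    wvec m g ≠ 0 := by
  obtain ⟨d, hd⟩ := ne_zero_iff.1 hne
  have hdeg : d.degree = m := by
    rw [Finsupp.degree_eq_weight_one]; exact hg hd
  intro h
  have := congrFun h ⟨d, hdeg⟩
  simp only [wvec, Pi.zero_apply, mul_eq_zero] at this
  rcases this with h1 | h2
  · exact hd h1
  · exact fact_ne_zero d h2

/-- **Proportionality**: if `L_v(D) = 0 ⟹ L_u(D) = 0` for all forms `D = polyOf c`, and `v ≠ 0`,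
then `u = μ • v`. -/
theorem exists_smul_of_ker_le {m : ℕ} (v u : {d : σ →₀ ℕ // d.degree = m} → ℂ) (hv : v ≠ 0)
    (h : ∀ c : {d : σ →₀ ℕ // d.degree = m} → ℂ, (∑ d, c d * v d) = 0 → (∑ d, c d * u d) = 0) :
    ∃ μ : ℂ, u = μ • v := by
  classical
  obtain ⟨d₀, hd₀⟩ : ∃ d₀, v d₀ ≠ 0 := by
    by_contra hcon; push Not at hcon; exact hv (funext hcon)
  refine ⟨u d₀ / v d₀, funext fun d => ?_⟩
  -- test vector c = v d₀ • e_d − v d • e_{d₀}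
  have key := h (fun e => (if e = d then v d₀ else 0) - (if e = d₀ then v d else 0)) ?_
  · simp only [sub_mul, Finset.sum_sub_distrib, ite_mul, zero_mul, Finset.sum_ite_eq',
      Finset.mem_univ, if_true] at key
    simp only [Pi.smul_apply, smul_eq_mul]
    field_simp
    linear_combination key
  · simp only [sub_mul, Finset.sum_sub_distrib, ite_mul, zero_mul, Finset.sum_ite_eq',
      Finset.mem_univ, if_true]
    ring

end Fin

/-! ## 3. Orbit facts for `det_m` -/

section Orbit

variable {ι : Type*} [Fintype ι] [DecidableEq ι]

/-- Elements of `GL · det` are nonzero. -/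
theorem ne_zero_of_mem_glOrbit_detPoly {P : MvPolynomial (ι × ι) ℂ}
    (hP : P ∈ glOrbit (ι × ι) ℂ (detPoly ι ℂ)) : P ≠ 0 := by
  obtain ⟨g, hg⟩ := hP
  intro h
  have h' : linSubstRep (ι × ι) ℂ g (detPoly ι ℂ) = 0 := hg.trans h
  have h2 : linSubstRep (ι × ι) ℂ g⁻¹ (linSubstRep (ι × ι) ℂ g (detPoly ι ℂ)) = detPoly ι ℂ := by
    rw [← Module.End.mul_apply, ← map_mul, inv_mul_cancel, map_one, Module.End.one_apply]
  have h3 : detPoly ι ℂ = 0 := by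
    rw [← h2, h', map_zero]
  have hne : detPoly ι ℂ ≠ 0 := by
    simpa [detPoly] using Matrix.det_mvPolynomialX_ne_zero ι ℂ
  exact hne h3

/-- Elements of `GL · det` are forms of degree `card ι`. -/
theorem isHomogeneous_of_mem_glOrbit_detPoly {P : MvPolynomial (ι × ι) ℂ}
    (hP : P ∈ glOrbit (ι × ι) ℂ (detPoly ι ℂ)) : P.IsHomogeneous (Fintype.card ι) := by
  obtain ⟨g, hg⟩ := hP
  rw [← hg]
  show (linSubstRep (ι × ι) ℂ g (detPoly ι ℂ)).IsHomogeneous (Fintype.card ι)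
  rw [linSubstRep_apply]
  exact linSubst_isHomogeneous _ detPoly_isHomogeneous

/-- Row scaling: the diagonal substitution scaling the variables of row `i₀` by `c`. -/
def rowScale (i₀ : ι) (c : ℂ) : Matrix (ι × ι) (ι × ι) ℂ :=
  Matrix.diagonal fun p => if p.1 = i₀ then c else 1

theorem linSubst_rowScale_X (i₀ : ι) (c : ℂ) (p : ι × ι) :
    linSubst (ι × ι) ℂ (rowScale i₀ c) (X p) = (if p.1 = i₀ then c else 1) • X p := by
  classical
  rw [linSubst_X, Finset.sum_eq_single p]
  · simp [rowScale]
  · intro q _ hq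
    simp [rowScale, Matrix.diagonal_apply_ne _ hq]
  · intro h; exact absurd (Finset.mem_univ p) h

/-- `c • det = (row scaling) · det`, so the orbit `GL · det` is a cone. -/
theorem linSubst_rowScale_detPoly (i₀ : ι) (c : ℂ) :
    linSubst (ι × ι) ℂ (rowScale i₀ c) (detPoly ι ℂ) = c • detPoly ι ℂ := by
  classical
  rw [detPoly, AlgHom.map_det]
  set X' : Matrix ι ι (MvPolynomial (ι × ι) ℂ) := Matrix.mvPolynomialX ι ι ℂ with hX'
  have hM : (linSubst (ι × ι) ℂ (rowScale i₀ c)).mapMatrix X' =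
      Matrix.updateRow X' i₀ ((C c : MvPolynomial (ι × ι) ℂ) • (fun j => X' i₀ j)) := by
    ext i j
    rw [AlgHom.mapMatrix_apply, Matrix.map_apply, Matrix.updateRow_apply]
    simp only [hX', Matrix.mvPolynomialX_apply, linSubst_rowScale_X]
    split_ifs with h
    · subst h
      simp [smul_eq_C_mul]
    · simp
  rw [hM, Matrix.det_updateRow_smul, show (fun j => X' i₀ j) = X' i₀ from rfl,
    Matrix.updateRow_eq_self, smul_eq_C_mul]

theorem smul_mem_glOrbit_detPoly [Nonempty ι] {P : MvPolynomial (ι × ι) ℂ}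
    (hP : P ∈ glOrbit (ι × ι) ℂ (detPoly ι ℂ)) {c : ℂ} (hc : c ≠ 0) :
    c • P ∈ glOrbit (ι × ι) ℂ (detPoly ι ℂ) := by
  classical
  obtain ⟨g, hg⟩ := hP
  obtain ⟨i₀⟩ := ‹Nonempty ι›
  have hdet : (rowScale i₀ c).det ≠ 0 := by
    rw [rowScale, Matrix.det_diagonal, Finset.prod_ne_zero_iff]
    intro p _
    split_ifs <;> simp [hc]
  refine ⟨g * Matrix.GeneralLinearGroup.mkOfDetNeZero _ hdet, ?_⟩
  rw [← hg]
  change linSubstRep (ι × ι) ℂ (g * Matrix.GeneralLinearGroup.mkOfDetNeZero _ hdet) (detPoly ι ℂ) =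
    c • linSubstRep (ι × ι) ℂ g (detPoly ι ℂ)
  rw [map_mul, Module.End.mul_apply, linSubstRep_apply, linSubstRep_apply]
  change linSubst (ι × ι) ℂ (g : Matrix (ι × ι) (ι × ι) ℂ)
      (linSubst (ι × ι) ℂ (rowScale i₀ c) (detPoly ι ℂ)) = c • linSubst (ι × ι) ℂ (g : Matrix _ _ ℂ) (detPoly ι ℂ)
  rw [linSubst_rowScale_detPoly, map_smul]

end Orbit

/-! ## 4. The padded permanent is a nonzero form -/

theorem paddedPerPoly_ne_zero (n m : ℕ) [NeZero m] : paddedPerPoly ℂ n m ≠ 0 := by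
  have hinj : Function.Injective
      (fun ij : BlockIdx n m × BlockIdx n m => ((ij.1 : Fin m), (ij.2 : Fin m))) := by
    intro a b h
    simp only [Prod.mk.injEq] at h
    exact Prod.ext (Subtype.ext h.1) (Subtype.ext h.2)
  have hper : rename (fun ij : BlockIdx n m × BlockIdx n m => ((ij.1 : Fin m), (ij.2 : Fin m)))
      (perPoly (BlockIdx n m) ℂ) ≠ 0 := by
    intro h
    apply perPoly_ne_zero (BlockIdx n m) ℂ
    exact rename_injective _ hinj (by rw [h, map_zero])
  unfold paddedPerPoly
  exact mul_ne_zero (pow_ne_zero _ (X_ne_zero _)) hper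

/-! ## 5. Euclidean limits of orbit points lie in the orbit closure -/

theorem mem_orbitClosure_of_tendsto {ι : Type*} [Fintype ι] [DecidableEq ι]
    {f g : MvPolynomial ι ℂ} (Q : ℕ → MvPolynomial ι ℂ) {φ : ℕ → ℕ}
    (hQ : ∀ t, Q t ∈ glOrbit ι ℂ f)
    (hlim : Tendsto (fun t => coeffVec (Q (φ t))) atTop (𝓝 (coeffVec g))) :
    g ∈ orbitClosure f := by
  rw [mem_orbitClosure_iff]
  intro p hp
  -- `x ↦ p(x)` is continuous in the product topology (a polynomial in finitely many coordinates)
  have hcont : Continuous fun x : (ι →₀ ℕ) → ℂ => eval x p := continuous_eval p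
  have h1 : Tendsto (fun t => eval (coeffVec (Q (φ t))) p) atTop (𝓝 (eval (coeffVec g) p)) :=
    (hcont.tendsto (coeffVec g)).comp hlim
  have hae : ∀ x : (ι →₀ ℕ) → ℂ, aeval x p = eval x p := fun x => by
    rw [aeval_def]
    rfl
  have h0 : ∀ t, eval (coeffVec (Q (φ t))) p = 0 := fun t => by
    rw [← hae]
    exact hp (Q (φ t)) (hQ (φ t))
  have h3 : Tendsto (fun _ : ℕ => (0 : ℂ)) atTop (𝓝 (eval (coeffVec g) p)) :=
    h1.congr h0
  have h4 : eval (coeffVec g) p = 0 := tendsto_nhds_unique h3 tendsto_const_nhds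
  rw [hae]
  exact h4

/-! ## 6. The theorem: a witness forces membership -/

section Main

variable [Fintype σ] [DecidableEq σ]

/-- `κ(u) := Σ_d conj(u_d) u_d ≠ 0` for `u ≠ 0`. -/
theorem sum_conj_mul_self_ne_zero {ι : Type*} [Fintype ι] {u : ι → ℂ} (hu : u ≠ 0) :
    (∑ d, conj (u d) * u d) ≠ 0 := by
  have h : (∑ d, conj (u d) * u d) = ((∑ d, ‖u d‖ ^ 2 : ℝ) : ℂ) := by
    push_cast
    refine Finset.sum_congr rfl fun d _ => ?_
    rw [Complex.conj_mul']
  rw [h]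
  intro h0
  have h0' : (∑ d, ‖u d‖ ^ 2 : ℝ) = 0 := by exact_mod_cast h0
  apply hu
  funext d
  have := (Finset.sum_eq_zero_iff_of_nonneg (fun d _ => sq_nonneg ‖u d‖)).1 h0' d (Finset.mem_univ d)
  exact norm_eq_zero.1 ((pow_eq_zero_iff two_ne_zero).1 this)

/-- **Step 1 (corrected annihilators).** Along a subsequence on which the normalised weighted
vectors `v (φ t) ∥ wvec (P (φ t))` converge to `u`, every degree-`m` form `D` with `L_u(D) = 0` is a
limit of annihilators of the `P (φ t)`, hence lies in `J m` by the limsup clause W3. [folklore] -/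
theorem mem_of_L_eq_zero {m : ℕ} {P : ℕ → MvPolynomial σ ℂ} {J : ℕ → Set (MvPolynomial σ ℂ)}
    (hPhom : ∀ t, (P t).IsHomogeneous m)
    (hW3 : ∀ (D : MvPolynomial σ ℂ) (φ : ℕ → ℕ) (Ds : ℕ → MvPolynomial σ ℂ), StrictMono φ →
      (∀ t, (Ds t).IsHomogeneous m ∧ apolarAction (Ds t) (P (φ t)) = 0) →
      Tendsto (fun t => coeffVec (Ds t)) atTop (𝓝 (coeffVec D)) → D ∈ J m)
    (v : ℕ → ({d : σ →₀ ℕ // d.degree = m} → ℂ)) (r : ℕ → ℂ)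
    (hwv : ∀ t, wvec m (P t) = r t • v t)
    {u : {d : σ →₀ ℕ // d.degree = m} → ℂ} (hune : u ≠ 0) {φ : ℕ → ℕ} (hφ : StrictMono φ)
    (hlim : Tendsto (fun t => v (φ t)) atTop (𝓝 u))
    {D : MvPolynomial σ ℂ} (hD : D.IsHomogeneous m) (hLD : L m u D = 0) : D ∈ J m := by
  classical
  obtain ⟨E, hE⟩ : ∃ E : MvPolynomial σ ℂ, E = polyOf m (fun d => conj (u d)) := ⟨_, rfl⟩
  have hEhom : E.IsHomogeneous m := hE ▸ polyOf_isHomogeneous _ _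
  obtain ⟨κ, hκ⟩ : ∃ κ : ℂ, κ = L m u E := ⟨_, rfl⟩
  have hκne : κ ≠ 0 := by
    rw [hκ, hE, L_polyOf]
    exact sum_conj_mul_self_ne_zero hune
  obtain ⟨Ds, hDs⟩ : ∃ Ds : ℕ → MvPolynomial σ ℂ,
      ∀ t, Ds t = κ⁻¹ • ((L m (v (φ t)) E) • D - (L m (v (φ t)) D) • E) := ⟨_, fun t => rfl⟩
  have hDshom : ∀ t, (Ds t).IsHomogeneous m := by
    intro t
    have hD' := (mem_homogeneousSubmodule m D).2 hD
    have hE' := (mem_homogeneousSubmodule m E).2 hEhom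
    rw [hDs, ← mem_homogeneousSubmodule]
    exact Submodule.smul_mem _ _ (Submodule.sub_mem _ (Submodule.smul_mem _ _ hD')
      (Submodule.smul_mem _ _ hE'))
  refine hW3 D φ Ds hφ (fun t => ⟨hDshom t, ?_⟩) ?_
  · -- `Ds t` annihilates `P (φ t)`: its pairing with `wvec (P (φ t)) ∥ v (φ t)` vanishes
    rw [apolarAction_eq_zero_iff (hDshom t) (hPhom (φ t)), hwv, L_smul_left, hDs,
      L_smul_poly, L_sub_poly, L_smul_poly, L_smul_poly]
    ring
  · -- `Ds t → D` coefficientwise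
    have hcL : ∀ X : MvPolynomial σ ℂ, Tendsto (fun t => L m (v (φ t)) X) atTop (𝓝 (L m u X)) :=
      fun X => ((continuous_L X).tendsto u).comp hlim
    rw [tendsto_pi_nhds]
    intro d
    have hcoord : (fun t => coeffVec (Ds t) d) =
        fun t => κ⁻¹ * (L m (v (φ t)) E * coeff d D - L m (v (φ t)) D * coeff d E) := by
      funext t
      rw [hDs, coeffVec_apply, coeff_smul, coeff_sub, coeff_smul, coeff_smul]
      simp only [smul_eq_mul]
    have hlim' : Tendsto (fun t => κ⁻¹ * (L m (v (φ t)) E * coeff d D - L m (v (φ t)) D * coeff d E))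
        atTop (𝓝 (κ⁻¹ * (L m u E * coeff d D - L m u D * coeff d E))) :=
      (((hcL E).mul tendsto_const_nhds).sub ((hcL D).mul tendsto_const_nhds)).const_mul _
    rw [hcoord]
    have hval : κ⁻¹ * (L m u E * coeff d D - L m u D * coeff d E) = coeffVec D d := by
      rw [hLD, ← hκ, zero_mul, sub_zero, ← mul_assoc, inv_mul_cancel₀ hκne, one_mul, coeffVec_apply]
    rw [← hval]
    exact hlim'

end Main

/-- **W1 ∧ W3@m ∧ W5@m ⟹ `X₀₀^{m−n} per_n ∈ Δ(det_m)`** (the mathematical content of support item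
`WitnessToMembership`, stmt-5782; `3 ≤ n` is not needed, W2 and W4 are not used). [folklore] -/
theorem mem_orbitClosure_of_witness {n m : ℕ} [NeZero m] (hnm : n ≤ m)
    (P : ℕ → MvPolynomial (Fin m × Fin m) ℂ) (J : ℕ → Set (MvPolynomial (Fin m × Fin m) ℂ))
    (hW1 : ∀ t, P t ∈ glOrbit (Fin m × Fin m) ℂ (detPoly (Fin m) ℂ))
    (hW3 : ∀ k ≤ m, ∀ (D : MvPolynomial (Fin m × Fin m) ℂ) (φ : ℕ → ℕ)
      (Ds : ℕ → MvPolynomial (Fin m × Fin m) ℂ), StrictMono φ →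
      (∀ t, (Ds t).IsHomogeneous k ∧ apolarAction (Ds t) (P (φ t)) = 0) →
      Tendsto (fun t => coeffVec (Ds t)) atTop (𝓝 (coeffVec D)) → D ∈ J k)
    (hW5 : ∀ k ≤ m, ∀ D ∈ J k, apolarAction D (paddedPerPoly ℂ n m) = 0) :
    paddedPerPoly ℂ n m ∈ orbitClosure (detPoly (Fin m) ℂ) := by
  classical
  have hPhom : ∀ t, (P t).IsHomogeneous m := fun t => by
    simpa [Fintype.card_fin] using isHomogeneous_of_mem_glOrbit_detPoly (hW1 t)
  have hPne : ∀ t, P t ≠ 0 := fun t => ne_zero_of_mem_glOrbit_detPoly (hW1 t)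
  -- weighted coefficient vectors, their norms, and the normalised vectors `v t`
  have hwne : ∀ t, wvec m (P t) ≠ 0 := fun t => wvec_ne_zero (hPhom t) (hPne t)
  have hnorm : ∀ t, ‖wvec m (P t)‖ ≠ 0 := fun t => norm_ne_zero_iff.2 (hwne t)
  have hnormC : ∀ t, ((‖wvec m (P t)‖ : ℝ) : ℂ) ≠ 0 := fun t => Complex.ofReal_ne_zero.2 (hnorm t)
  obtain ⟨v, hv⟩ : ∃ v : ℕ → ({d : (Fin m × Fin m) →₀ ℕ // d.degree = m} → ℂ),
      ∀ t, v t = ((‖wvec m (P t)‖ : ℝ) : ℂ)⁻¹ • wvec m (P t) := ⟨_, fun t => rfl⟩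
  have hvs : ∀ t, v t ∈ Metric.sphere (0 : {d : (Fin m × Fin m) →₀ ℕ // d.degree = m} → ℂ) 1 := by
    intro t
    rw [mem_sphere_zero_iff_norm, hv, norm_smul, norm_inv, Complex.norm_real, norm_norm,
      inv_mul_cancel₀ (hnorm t)]
  obtain ⟨u, hu, φ, hφ, hlim⟩ := (isCompact_sphere _ _).tendsto_subseq hvs
  have hlim1 : Tendsto (fun t => v (φ t)) atTop (𝓝 u) := hlim
  have hune : u ≠ 0 := by
    intro h
    rw [h, mem_sphere_zero_iff_norm, norm_zero] at hu
    exact zero_ne_one hu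
  have hwv : ∀ t, wvec m (P t) = ((‖wvec m (P t)‖ : ℝ) : ℂ) • v t := by
    intro t
    rw [hv, smul_smul, mul_inv_cancel₀ (hnormC t), one_smul]
  -- Step 1: forms with `L_u = 0` lie in `J m`
  have key : ∀ D : MvPolynomial (Fin m × Fin m) ℂ, D.IsHomogeneous m → L m u D = 0 → D ∈ J m :=
    fun D hD hLD => mem_of_L_eq_zero hPhom (hW3 m le_rfl) v _ hwv hune hφ hlim1 hD hLD
  -- Step 2: `L_u D = 0 ⟹ L_{w_pp} D = 0`, hence `w_pp = μ • u`
  have hpphom : (paddedPerPoly ℂ n m).IsHomogeneous m := paddedPerPoly_isHomogeneous hnm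
  have himp : ∀ c : {d : (Fin m × Fin m) →₀ ℕ // d.degree = m} → ℂ,
      (∑ d, c d * u d) = 0 → (∑ d, c d * wvec m (paddedPerPoly ℂ n m) d) = 0 := by
    intro c hc
    have hD := key (polyOf m c) (polyOf_isHomogeneous m c) (by rw [L_polyOf]; exact hc)
    have h5 := hW5 m le_rfl _ hD
    rw [apolarAction_eq_zero_iff (polyOf_isHomogeneous m c) hpphom, L_polyOf] at h5
    exact h5
  obtain ⟨μ, hμ⟩ := exists_smul_of_ker_le u _ hune himp
  have hμne : μ ≠ 0 := by
    rintro rfl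
    rw [zero_smul] at hμ
    exact wvec_ne_zero hpphom (paddedPerPoly_ne_zero n m) hμ
  -- Step 3: the rescaled orbit sequence converges to `pp` coefficientwise
  obtain ⟨c, hc⟩ : ∃ c : ℕ → ℂ, ∀ t, c t = μ * ((‖wvec m (P (φ t))‖ : ℝ) : ℂ)⁻¹ :=
    ⟨_, fun t => rfl⟩
  have hcne : ∀ t, c t ≠ 0 := fun t => by
    rw [hc]; exact mul_ne_zero hμne (inv_ne_zero (hnormC (φ t)))
  have hlim2 : Tendsto (fun t => coeffVec (c t • P (φ t))) atTop
      (𝓝 (coeffVec (paddedPerPoly ℂ n m))) := by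
    rw [tendsto_pi_nhds]
    intro d
    by_cases hd : d.degree = m
    · have hvd : Tendsto (fun t => v (φ t) ⟨d, hd⟩) atTop (𝓝 (u ⟨d, hd⟩)) :=
        ((continuous_apply _).tendsto u).comp hlim1
      have h1 : (fun t => coeffVec (c t • P (φ t)) d) =
          fun t => (μ * (fact d)⁻¹) * v (φ t) ⟨d, hd⟩ := by
        funext t
        rw [coeffVec_apply, coeff_smul, smul_eq_mul, hc, hv]
        simp only [Pi.smul_apply, smul_eq_mul, wvec]
        field_simp [fact_ne_zero d, hnormC (φ t)]
      have h2 : coeffVec (paddedPerPoly ℂ n m) d = (μ * (fact d)⁻¹) * u ⟨d, hd⟩ := by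
        have := congrFun hμ ⟨d, hd⟩
        simp only [wvec, Pi.smul_apply, smul_eq_mul] at this
        rw [coeffVec_apply]
        field_simp [fact_ne_zero d]
        linear_combination this
      rw [h1, h2]
      exact hvd.const_mul _
    · have h1 : (fun t => coeffVec (c t • P (φ t)) d) = fun _ => 0 := by
        funext t
        rw [coeffVec_apply, coeff_smul, (hPhom (φ t)).coeff_eq_zero hd, smul_zero]
      have h2 : coeffVec (paddedPerPoly ℂ n m) d = 0 := hpphom.coeff_eq_zero hd
      rw [h1, h2]
      exact tendsto_const_nhds
  -- Step 4: the rescaled sequence stays in the orbit (cone), so `pp` is in the closure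
  exact mem_orbitClosure_of_tendsto (φ := id) (fun t => c t • P (φ t))
    (fun t => smul_mem_glOrbit_detPoly (hW1 _) (hcne t)) hlim2

/-- **`WitnessToMembership` (stmt-ValiantsHypothesis-5782) holds.** [folklore] -/
theorem witnessToMembership_holds : WitnessToMembership := by
  intro n m _ _ hnm act rk
  rintro ⟨P, J, h1, -, h3, -, h5⟩
  exact mem_orbitClosure_of_witness hnm P J h1 h3 h5

end

end Summit.ValiantsHypothesis.ValiantsHypothesis.Cruxes.FixedWitnessObstructionQP.Disproof.WTM

/-! ## §8 Unconditional corollaries of §7 -/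

namespace Summit.ValiantsHypothesis.ValiantsHypothesis.Cruxes.FixedWitnessObstructionQP.Disproof

open Literature.Computability.AlgebraicComplexity
open Summit.ValiantsHypothesis.ValiantsHypothesis.Theses.BorderApolarity

set_option linter.dupNamespace false

/-- **GctWindow ⟹ X, unconditionally** (the quasi-polynomial Mulmuley–Sohoni thesis implies the
crux; equivalently ¬X refutes the thesis). [folklore] -/
theorem crux_of_gctThesis (hG : GctWindow) : FixedWitnessObstructionQP :=
  crux_of_gctWindow WTM.witnessToMembership_holds hG

/-- **X ⟺ GctWindow given only the Borel support item.** [folklore] -/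
theorem crux_iff_gctWindow' (hB : BorelFixedBorderApolarity) : FixedWitnessObstructionQP ↔ GctWindow :=
  crux_iff_gctWindow hB WTM.witnessToMembership_holds

/-- The `c = 1` slice of X is an unconditional theorem (LMR13 + §7). [cite: LandsbergManivelRessayre2013, Theorem 1.1.1] -/
theorem crux_slice_one' :
    ∃ n₀ : ℕ, ∀ n ≥ n₀, ∀ (m : ℕ) [NeZero m], n ≤ m → m ≤ 2 ^ ((Nat.log 2 n + 1) ^ 1) →
      ¬ WitnessExists n m :=
  crux_slice_one WTM.witnessToMembership_holds

/-- **Pointwise form**: a witness at `(n, m)` with `n ≤ m` forces membership (no `3 ≤ n`). [folklore] -/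
theorem mem_of_witnessExists {n m : ℕ} [NeZero m] (hnm : n ≤ m) (h : WitnessExists n m) :
    paddedPerPoly ℂ n m ∈ orbitClosure (detPoly (Fin m) ℂ) := by
  obtain ⟨P, J, h1, -, h3, -, h5⟩ := h
  exact WTM.mem_orbitClosure_of_witness hnm P J h1 h3 h5

/-- **LMR kills every witness with `2m < n²`**, unconditionally: e.g. no witness at (3,3), (3,4),
(4,4..7), (n, m < n²/2). [cite: LandsbergManivelRessayre2013, Theorem 1.1.1] -/
theorem not_witnessExists_of_lt {n m : ℕ} [NeZero m] (hnm : n ≤ m) (hlt : 2 * m < n ^ 2) :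
    ¬ WitnessExists n m := fun h =>
  absurd (LMR2013_thm_1_1_1_holds n m hnm (mem_of_witnessExists hnm h)) (not_le.2 hlt)

/-- In particular the route's calibration instance `(n, m) = (3, 4)` carries no witness. [cite: LandsbergManivelRessayre2013, Theorem 1.1.1] -/
theorem not_witnessExists_three_four : ¬ WitnessExists 3 4 :=
  not_witnessExists_of_lt (by norm_num) (by norm_num)

end Summit.ValiantsHypothesis.ValiantsHypothesis.Cruxes.FixedWitnessObstructionQP.Disproof

/-! ## §9 Bilinearity of `apolarAction`, the derivative rule, and the collapse of W5 to degree m -/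

namespace Summit.ValiantsHypothesis.ValiantsHypothesis.Cruxes.FixedWitnessObstructionQP.Disproof.Bilin

open Literature.Computability.AlgebraicComplexity
open MvPolynomial Filter
open scoped BigOperators Topology Matrix

set_option linter.dupNamespace false
set_option linter.unusedSectionVars false

noncomputable section

variable {σ : Type*} {k : Type*} [CommRing k] [DecidableEq σ]

/-- The descending-factorial coefficient `c(d,e) = ∏_{i ∈ supp e} dᵢ!/(dᵢ−eᵢ)!`. -/
def dcoef (d e : σ →₀ ℕ) : k := ∏ i ∈ e.support, (Nat.descFactorial (d i) (e i) : k)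

/-- `apolarAction` as an iterated `Finsupp.sum` over the coefficient functions. -/
theorem apolarAction_eq_sum (D f : MvPolynomial σ k) :
    apolarAction D f = (AddMonoidAlgebra.coeff D).sum (fun e a =>
      (AddMonoidAlgebra.coeff f).sum (fun d b => monomial (d - e) (a * b * dcoef d e))) :=
  rfl

/-! ## Bilinearity -/

theorem apolarAction_add_left (D E f : MvPolynomial σ k) :
    apolarAction (D + E) f = apolarAction D f + apolarAction E f := by
  rw [apolarAction_eq_sum, apolarAction_eq_sum, apolarAction_eq_sum, AddMonoidAlgebra.coeff_add]
  apply Finsupp.sum_add_index'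
  · intro e
    simp [Finsupp.sum]
  · intro e a₁ a₂
    simp only [Finsupp.sum, ← Finset.sum_add_distrib, ← map_add]
    refine Finset.sum_congr rfl fun d _ => ?_
    congr 1
    ring

theorem apolarAction_add_right (D f g : MvPolynomial σ k) :
    apolarAction D (f + g) = apolarAction D f + apolarAction D g := by
  rw [apolarAction_eq_sum, apolarAction_eq_sum, apolarAction_eq_sum, AddMonoidAlgebra.coeff_add,
    ← Finsupp.sum_add]
  refine Finsupp.sum_congr fun e _ => ?_
  apply Finsupp.sum_add_index'
  · intro d
    simp
  · intro d b₁ b₂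
    rw [← map_add]
    congr 1
    ring

theorem apolarAction_smul_left (c : k) (D f : MvPolynomial σ k) :
    apolarAction (c • D) f = c • apolarAction D f := by
  rw [apolarAction_eq_sum, apolarAction_eq_sum, AddMonoidAlgebra.coeff_smul, Finsupp.sum_smul_index']
  · simp only [Finsupp.sum, Finset.smul_sum, smul_monomial, smul_eq_mul]
    refine Finset.sum_congr rfl fun e _ => Finset.sum_congr rfl fun d _ => ?_
    congr 1
    ring
  · intro e
    simp [Finsupp.sum]

theorem apolarAction_smul_right (c : k) (D f : MvPolynomial σ k) :
    apolarAction D (c • f) = c • apolarAction D f := by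
  rw [apolarAction_eq_sum, apolarAction_eq_sum, AddMonoidAlgebra.coeff_smul, Finsupp.smul_sum]
  refine Finsupp.sum_congr fun e _ => ?_
  rw [Finsupp.sum_smul_index', Finsupp.smul_sum]
  · refine Finsupp.sum_congr fun d _ => ?_
    rw [smul_monomial, smul_eq_mul]
    congr 1
    ring
  · intro d
    simp

theorem apolarAction_sum_left {ι : Type*} (s : Finset ι) (D : ι → MvPolynomial σ k)
    (f : MvPolynomial σ k) : apolarAction (∑ i ∈ s, D i) f = ∑ i ∈ s, apolarAction (D i) f := by
  classical
  induction s using Finset.induction_on with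
  | empty => simp
  | insert a s ha ih => rw [Finset.sum_insert ha, Finset.sum_insert ha, apolarAction_add_left, ih]

theorem apolarAction_sum_right {ι : Type*} (s : Finset ι) (D : MvPolynomial σ k)
    (f : ι → MvPolynomial σ k) : apolarAction D (∑ i ∈ s, f i) = ∑ i ∈ s, apolarAction D (f i) := by
  classical
  induction s using Finset.induction_on with
  | empty => simp
  | insert a s ha ih => rw [Finset.sum_insert ha, Finset.sum_insert ha, apolarAction_add_right, ih]

theorem apolarAction_sub_left (D E f : MvPolynomial σ k) :
    apolarAction (D - E) f = apolarAction D f - apolarAction E f := by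
  rw [sub_eq_add_neg, apolarAction_add_left, ← neg_one_smul k E, apolarAction_smul_left, neg_one_smul,
    sub_eq_add_neg]

/-! ## Monomial formula and the derivative rule -/

theorem apolarAction_monomial_monomial' (e d : σ →₀ ℕ) (a b : k) :
    apolarAction (monomial e a) (monomial d b) = monomial (d - e) (a * b * dcoef d e) := by
  classical
  rw [apolarAction_monomial_monomial]
  rfl

/-- `c(d, e + eᵢ) = c(d, e) · (dᵢ − eᵢ)`, unconditionally. -/
theorem dcoef_add_single (d e : σ →₀ ℕ) (i : σ) :
    (dcoef d (e + Finsupp.single i 1) : k) = dcoef d e * ((d i - e i : ℕ) : k) := by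
  classical
  unfold dcoef
  set S := insert i e.support with hS
  have hsub1 : (e + Finsupp.single i 1).support ⊆ S := by
    intro j hj
    rw [hS, Finset.mem_insert]
    by_cases hji : j = i
    · exact Or.inl hji
    · right
      rw [Finsupp.mem_support_iff] at hj ⊢
      simpa [Finsupp.single_apply, Ne.symm hji] using hj
  have hsub2 : e.support ⊆ S := Finset.subset_insert _ _
  have h1 : ∏ j ∈ (e + Finsupp.single i 1).support,
      ((Nat.descFactorial (d j) ((e + Finsupp.single i 1 : σ →₀ ℕ) j) : ℕ) : k) =
      ∏ j ∈ S, ((Nat.descFactorial (d j) ((e + Finsupp.single i 1 : σ →₀ ℕ) j) : ℕ) : k) :=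
    Finset.prod_subset hsub1 fun j _ hj => by
      rw [Finsupp.notMem_support_iff] at hj
      rw [hj, Nat.descFactorial_zero, Nat.cast_one]
  have h2 : ∏ j ∈ e.support, ((Nat.descFactorial (d j) (e j) : ℕ) : k) =
      ∏ j ∈ S, ((Nat.descFactorial (d j) (e j) : ℕ) : k) :=
    Finset.prod_subset hsub2 fun j _ hj => by
      rw [Finsupp.notMem_support_iff] at hj
      rw [hj, Nat.descFactorial_zero, Nat.cast_one]
  have hi : i ∈ S := Finset.mem_insert_self _ _
  rw [h1, h2, ← Finset.mul_prod_erase S _ hi, ← Finset.mul_prod_erase S _ hi]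
  have h3 : ∏ j ∈ S.erase i, ((Nat.descFactorial (d j) ((e + Finsupp.single i 1 : σ →₀ ℕ) j) : ℕ) : k) =
      ∏ j ∈ S.erase i, ((Nat.descFactorial (d j) (e j) : ℕ) : k) := by
    refine Finset.prod_congr rfl fun j hj => ?_
    have hji : j ≠ i := Finset.ne_of_mem_erase hj
    simp [hji.symm]
  rw [h3]
  simp only [Finsupp.add_apply, Finsupp.single_eq_same]
  rw [Nat.descFactorial_succ]
  push_cast
  ring

/-- **Derivative rule**: `(Xᵢ · D) ⌟ f = Xᵢ ⌟ (D ⌟ f)` (i.e. `∂ᵢ ∘ D(∂) = (∂ᵢ D)(∂)`). [folklore] -/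
theorem apolarAction_X_mul (i : σ) (D f : MvPolynomial σ k) :
    apolarAction (X i * D) f = apolarAction (X i) (apolarAction D f) := by
  classical
  -- reduce to monomials by bilinearity
  conv_lhs => rw [as_sum D, as_sum f, Finset.mul_sum]
  conv_rhs => rw [as_sum D, as_sum f]
  simp only [apolarAction_sum_left, apolarAction_sum_right]
  refine Finset.sum_congr rfl fun e _ => Finset.sum_congr rfl fun d _ => ?_
  rw [X, monomial_mul, apolarAction_monomial_monomial', apolarAction_monomial_monomial',
    apolarAction_monomial_monomial', one_mul, add_comm (Finsupp.single i 1), dcoef_add_single,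
    tsub_tsub]
  congr 1
  have hc : ∀ u : σ →₀ ℕ, (dcoef u (Finsupp.single i 1) : k) = ((u i : ℕ) : k) := by
    intro u
    unfold dcoef
    rw [Finsupp.support_single _ one_ne_zero, Finset.prod_singleton, Finsupp.single_eq_same,
      Nat.descFactorial_one]
  rw [hc, Finsupp.tsub_apply]
  ring

/-- Coefficients of `Xᵢ ⌟ g` (the partial derivative): `(Xᵢ ⌟ g)_u = (uᵢ + 1) g_{u + eᵢ}`. [folklore] -/
theorem coeff_apolarAction_X (i : σ) (g : MvPolynomial σ k) (u : σ →₀ ℕ) :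
    coeff u (apolarAction (X i) g) = ((u i + 1 : ℕ) : k) * coeff (u + Finsupp.single i 1) g := by
  classical
  conv_lhs => rw [as_sum g]
  rw [apolarAction_sum_right, coeff_sum]
  simp only [X, apolarAction_monomial_monomial', one_mul, coeff_monomial]
  have hc : ∀ d : σ →₀ ℕ, (dcoef d (Finsupp.single i 1) : k) = ((d i : ℕ) : k) := by
    intro d
    unfold dcoef
    rw [Finsupp.support_single _ one_ne_zero, Finset.prod_singleton, Finsupp.single_eq_same,
      Nat.descFactorial_one]
  simp only [hc]
  rw [Finset.sum_eq_single (u + Finsupp.single i 1)]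
  · simp only [add_tsub_cancel_right, if_true, Finsupp.add_apply, Finsupp.single_eq_same]
    ring
  · intro d _ hne
    split_ifs with h
    · -- d - eᵢ = u but d ≠ u + eᵢ forces dᵢ = 0
      have hdi : d i = 0 := by
        by_contra hpos
        apply hne
        ext j
        have := congrArg (fun f : σ →₀ ℕ => f j) h
        simp only [Finsupp.tsub_apply, Finsupp.single_apply] at this
        simp only [Finsupp.add_apply, Finsupp.single_apply]
        by_cases hji : i = j
        · subst hji; simp only [if_true] at this ⊢; omega
        · simp only [if_neg hji] at this ⊢; omega
      rw [hdi, Nat.cast_zero, mul_zero]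
    · rfl
  · intro hn
    rw [if_pos (add_tsub_cancel_right _ _), notMem_support_iff.1 hn, zero_mul]

/-- A form of positive degree all of whose first partials vanish is zero (char 0). [folklore] -/
theorem eq_zero_of_forall_apolarAction_X [CharZero k] [IsDomain k] {g : MvPolynomial σ k} {j : ℕ}
    (hg : g.IsHomogeneous j) (hj : 1 ≤ j) (h : ∀ i, apolarAction (X i) g = 0) : g = 0 := by
  classical
  by_contra hne
  obtain ⟨d, hd⟩ := ne_zero_iff.1 hne
  have hdeg : d.degree = j := by
    rw [Finsupp.degree_eq_weight_one]; exact hg hd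
  obtain ⟨i, hi⟩ : ∃ i, d i ≠ 0 := by
    by_contra hcon
    push Not at hcon
    have : d = 0 := Finsupp.ext hcon
    rw [this, map_zero] at hdeg
    omega
  have key := congrArg (coeff (d - Finsupp.single i 1)) (h i)
  rw [coeff_apolarAction_X, coeff_zero] at key
  have hsub : d - Finsupp.single i 1 + Finsupp.single i 1 = d := by
    apply tsub_add_cancel_of_le
    exact Finsupp.single_le_iff.2 (Nat.one_le_iff_ne_zero.2 hi)
  rw [hsub] at key
  rcases mul_eq_zero.1 key with h1 | h2
  · exact absurd h1 (Nat.cast_ne_zero.2 (Nat.succ_ne_zero _))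
  · exact hd h2

/-- `apolarAction` of forms is a form: `deg (D ⌟ f) = deg f − deg D`. [folklore] -/
theorem apolarAction_isHomogeneous {D f : MvPolynomial σ k} {j m : ℕ} (hD : D.IsHomogeneous j)
    (hf : f.IsHomogeneous m) : (apolarAction D f).IsHomogeneous (m - j) := by
  classical
  rw [apolarAction_def]
  refine IsHomogeneous.sum _ _ _ fun e he => IsHomogeneous.sum _ _ _ fun d hd => ?_
  by_cases hle : e ≤ d
  · apply isHomogeneous_monomial
    have hedeg : e.degree = j := by
      rw [Finsupp.degree_eq_weight_one]; exact hD (mem_support_iff.1 he)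
    have hddeg : d.degree = m := by
      rw [Finsupp.degree_eq_weight_one]; exact hf (mem_support_iff.1 hd)
    have : (d - e).degree + e.degree = d.degree := by
      rw [← map_add, tsub_add_cancel_of_le hle]
    omega
  · have := apolarAction_monomial_monomial_of_not_le hle (coeff e D) (coeff d f)
    rw [apolarAction_monomial_monomial] at this
    rw [this]
    exact isHomogeneous_zero _ _ _

/-! ## Collapse of the apolarity clause W5 to its top degree -/

/-- Multiplication by `Xᵢ` is coefficientwise continuous. [folklore] -/
theorem tendsto_coeffVec_X_mul {Ds : ℕ → MvPolynomial σ ℂ} {D : MvPolynomial σ ℂ} (i : σ)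
    (h : Tendsto (fun t => coeffVec (Ds t)) atTop (𝓝 (coeffVec D))) :
    Tendsto (fun t => coeffVec (X i * Ds t)) atTop (𝓝 (coeffVec (X i * D))) := by
  classical
  rw [tendsto_pi_nhds] at h ⊢
  intro u
  simp only [coeffVec_apply, coeff_X_mul']
  split_ifs with hu
  · exact h _
  · exact tendsto_const_nhds

/-- **W5 collapses to degree `m`.** For a border-apolarity limit `J` (Li ∧ Ls up to degree `m`)
and a form `g` of degree `m`: if `J_m ⌟ g = 0` then `J_j ⌟ g = 0` for every `j ≤ m`.  Reason: `J` is
stable under `D ↦ Xᵢ·D` (limits of ideals), `(Xᵢ D) ⌟ g = ∂ᵢ(D ⌟ g)`, and a form of positive degree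
with all partials zero vanishes.  So the only apolarity information in a witness is ONE hyperplane
condition `J_m = g^⊥_m`. [folklore] -/
theorem apolar_all_of_top {m : ℕ} {P : ℕ → MvPolynomial σ ℂ} {J : ℕ → Set (MvPolynomial σ ℂ)}
    (hJ : IsBorderApolarLimit m P J) {g : MvPolynomial σ ℂ} (hg : g.IsHomogeneous m)
    (htop : ∀ D ∈ J m, apolarAction D g = 0) :
    ∀ j ≤ m, ∀ D ∈ J j, apolarAction D g = 0 := by
  classical
  suffices H : ∀ r j, j + r = m → ∀ D ∈ J j, apolarAction D g = 0 by
    intro j hj D hD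
    exact H (m - j) j (by omega) D hD
  intro r
  induction r with
  | zero =>
    intro j hj D hD
    rw [add_zero] at hj
    subst hj
    exact htop D hD
  | succ r ih =>
    intro j hj D hD
    have hjm : j ≤ m := by omega
    have hDhom : D.IsHomogeneous j := hJ.isHomogeneous_of_mem hjm hD
    have hX : ∀ i, X i * D ∈ J (j + 1) := by
      intro i
      obtain ⟨Ds, hDs, hlim⟩ := hJ.exists_tendsto hjm hD
      refine hJ.mem_of_tendsto (k := j + 1) (by omega) (φ := id) (Ds := fun t => X i * Ds t)
        strictMono_id (fun t => ⟨?_, ?_⟩) (tendsto_coeffVec_X_mul i hlim)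
      · have := (isHomogeneous_X ℂ i).mul (hDs t).1
        rwa [add_comm] at this
      · change apolarAction (X i * Ds t) (P t) = 0
        rw [apolarAction_X_mul, (hDs t).2, apolarAction_zero_right]
    have hzero : ∀ i, apolarAction (X i) (apolarAction D g) = 0 := fun i => by
      rw [← apolarAction_X_mul]
      exact ih (j + 1) (by omega) _ (hX i)
    exact eq_zero_of_forall_apolarAction_X (apolarAction_isHomogeneous hDhom hg) (by omega) hzero

/-! ## `Xᵢ ⌟ ·` is the partial derivative; multiplicativity; GL-equivariance -/

section Equivariance

variable [Fintype σ]

omit [Fintype σ] in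
/-- `C a ⌟ g = a • g`. [folklore] -/
theorem apolarAction_C (a : k) (g : MvPolynomial σ k) : apolarAction (C a) g = a • g := by
  classical
  conv_lhs => rw [as_sum g]
  rw [apolarAction_sum_right]
  conv_rhs => rw [as_sum g, Finset.smul_sum]
  refine Finset.sum_congr rfl fun d _ => ?_
  rw [← monomial_zero', apolarAction_monomial_monomial', tsub_zero, smul_monomial, smul_eq_mul]
  congr 1
  unfold dcoef
  rw [Finsupp.support_zero, Finset.prod_empty, mul_one]

omit [Fintype σ] in
/-- `Xᵢ ⌟ g = ∂g/∂xᵢ` (Mathlib's `pderiv`). [folklore] -/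
theorem apolarAction_X (i : σ) (g : MvPolynomial σ k) : apolarAction (X i) g = pderiv i g := by
  classical
  conv_lhs => rw [as_sum g]
  conv_rhs => rw [as_sum g]
  rw [apolarAction_sum_right, map_sum]
  refine Finset.sum_congr rfl fun d _ => ?_
  rw [X, apolarAction_monomial_monomial', pderiv_monomial, one_mul]
  congr 1
  unfold dcoef
  rw [Finsupp.support_single _ one_ne_zero, Finset.prod_singleton, Finsupp.single_eq_same,
    Nat.descFactorial_one]

omit [Fintype σ] in
/-- **Multiplicativity**: `(D₁ D₂) ⌟ f = D₁ ⌟ (D₂ ⌟ f)` — `f ↦ D ⌟ f` is a `k[∂]`-module structure. [folklore] -/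
theorem apolarAction_mul (D₁ D₂ f : MvPolynomial σ k) :
    apolarAction (D₁ * D₂) f = apolarAction D₁ (apolarAction D₂ f) := by
  classical
  induction D₁ using MvPolynomial.induction_on generalizing D₂ with
  | C a =>
    rw [apolarAction_C, ← smul_eq_C_mul, apolarAction_smul_left]
  | add p q hp hq =>
    rw [add_mul, apolarAction_add_left, apolarAction_add_left, hp, hq]
  | mul_X p i hp =>
    rw [mul_comm p (X i), mul_assoc, apolarAction_X_mul, hp, ← apolarAction_X_mul]

/-- Chain rule for a single partial derivative through a linear substitution:
`∂ᵢ(g ∘ Aᵀ) = Σ_j A i j · (∂ⱼ g) ∘ Aᵀ`, i.e. `Xᵢ ⌟ (A·g) = A·((Aᵀ·Xᵢ) ⌟ g)`. [folklore] -/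
theorem pderiv_linSubst (A : Matrix σ σ k) (i : σ) (g : MvPolynomial σ k) :
    pderiv i (linSubst σ k A g) = ∑ j, A i j • linSubst σ k A (pderiv j g) := by
  classical
  induction g using MvPolynomial.induction_on with
  | C c =>
    simp
  | add p q hp hq =>
    simp only [map_add, hp, hq, smul_add, Finset.sum_add_distrib]
  | mul_X p l hp =>
    have h1 : pderiv i (linSubst σ k A (X l)) = C (A i l) := by
      rw [linSubst_X, map_sum, Finset.sum_eq_single i]
      · rw [Derivation.map_smul, pderiv_X, Pi.single_eq_same, smul_eq_C_mul, mul_one]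
      · intro j _ hji
        rw [Derivation.map_smul, pderiv_X, Pi.single_eq_of_ne hji, smul_zero]
      · intro h
        exact absurd (Finset.mem_univ i) h
    have lhs : pderiv i (linSubst σ k A (p * X l)) =
        A i l • linSubst σ k A p + linSubst σ k A (X l) * pderiv i (linSubst σ k A p) := by
      rw [map_mul, Derivation.leibniz, h1, smul_eq_mul, smul_eq_mul, mul_comm (linSubst σ k A p) (C _),
        ← smul_eq_C_mul]
    have hj : ∀ j, linSubst σ k A (pderiv j (p * X l)) =
        (if l = j then linSubst σ k A p else 0) + linSubst σ k A (X l) * linSubst σ k A (pderiv j p) := by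
      intro j
      rw [Derivation.leibniz, pderiv_X, smul_eq_mul, smul_eq_mul, map_add, map_mul, map_mul]
      congr 1
      simp only [Pi.single_apply]
      split_ifs with h <;> simp
    have rhs : (∑ j, A i j • linSubst σ k A (pderiv j (p * X l))) =
        A i l • linSubst σ k A p + linSubst σ k A (X l) * ∑ j, A i j • linSubst σ k A (pderiv j p) := by
      simp only [hj, smul_add, Finset.sum_add_distrib]
      congr 1
      · simp only [smul_ite, smul_zero, Finset.sum_ite_eq, Finset.mem_univ, if_true]
      · rw [Finset.mul_sum]
        refine Finset.sum_congr rfl fun j _ => ?_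
        rw [mul_smul_comm]
    rw [lhs, rhs, hp]

/-- **GL-equivariance of apolarity**: `D ⌟ (A·f) = A·((Aᵀ·D) ⌟ f)` for every matrix `A`
(`A·f = linSubst A f = f ∘ Aᵀ`).  In particular, for invertible `A`,
`Ann(A·f) = {D : Aᵀ·D ∈ Ann f}` — the transport rule behind W4 of the crux. [folklore] -/
theorem apolarAction_linSubst (A : Matrix σ σ k) (D f : MvPolynomial σ k) :
    apolarAction D (linSubst σ k A f) = linSubst σ k A (apolarAction (linSubst σ k Aᵀ D) f) := by
  classical
  induction D using MvPolynomial.induction_on generalizing f with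
  | C a =>
    rw [linSubst_C, apolarAction_C, apolarAction_C, map_smul]
  | add p q hp hq =>
    rw [apolarAction_add_left, map_add, apolarAction_add_left, map_add, hp, hq]
  | mul_X p i hp =>
    rw [mul_comm p (X i), apolarAction_X_mul, hp, apolarAction_X, pderiv_linSubst, map_mul,
      apolarAction_mul, linSubst_X, apolarAction_sum_left, map_sum]
    refine Finset.sum_congr rfl fun j _ => ?_
    rw [apolarAction_smul_left, map_smul, apolarAction_X, Matrix.transpose_apply]

/-- Hence, for invertible `A`: `D ∈ Ann(A·f) ↔ Aᵀ·D ∈ Ann(f)`. [folklore] -/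
theorem apolarAction_linSubst_eq_zero_iff (A : Matrix σ σ k) (hA : IsUnit A.det) (D f : MvPolynomial σ k) :
    apolarAction D (linSubst σ k A f) = 0 ↔ apolarAction (linSubst σ k Aᵀ D) f = 0 := by
  rw [apolarAction_linSubst]
  constructor
  · intro h
    have hinj : Function.Injective (linSubst σ k A) := by
      intro x y hxy
      have := congrArg (linSubst σ k A⁻¹) hxy
      simp only [← AlgHom.comp_apply, ← linSubst_mul, Matrix.nonsing_inv_mul _ hA, linSubst_one,
        AlgHom.id_apply] at this
      exact this
    exact hinj (h.trans (map_zero _).symm)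
  · intro h
    rw [h, map_zero]

end Equivariance


/-! ## Torus semi-invariance of `det` and torus stability of `Ann(det)`; closedness of `Ann_k` -/

section Torus

variable {K : Type*} [Field K] {ι : Type*} [Fintype ι] [DecidableEq ι]

/-- The rank-one diagonal substitution `x_{ij} ↦ aᵢ bⱼ x_{ij}`. -/
def torusDiag (a b : ι → K) : Matrix (ι × ι) (ι × ι) K := Matrix.diagonal fun p => a p.1 * b p.2

theorem torusDiag_transpose (a b : ι → K) : (torusDiag a b)ᵀ = torusDiag a b :=
  Matrix.diagonal_transpose _

theorem linSubst_torusDiag_X (a b : ι → K) (p : ι × ι) :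
    linSubst (ι × ι) K (torusDiag a b) (X p) = (a p.1 * b p.2) • X p := by
  classical
  rw [linSubst_X, Finset.sum_eq_single p]
  · simp [torusDiag]
  · intro q _ hq
    simp [torusDiag, Matrix.diagonal_apply_ne _ hq]
  · intro h; exact absurd (Finset.mem_univ p) h

/-- **Torus semi-invariance of the determinant**: `det(aᵢ bⱼ x_{ij}) = (∏ aᵢ)(∏ bⱼ) det(x)`. [folklore] -/
theorem linSubst_torusDiag_detPoly (a b : ι → K) :
    linSubst (ι × ι) K (torusDiag a b) (detPoly ι K) = ((∏ i, a i) * ∏ j, b j) • detPoly ι K := by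
  classical
  rw [detPoly, AlgHom.map_det]
  set X' : Matrix ι ι (MvPolynomial (ι × ι) K) := Matrix.mvPolynomialX ι ι K with hX'
  have hM : (linSubst (ι × ι) K (torusDiag a b)).mapMatrix X' =
      Matrix.diagonal (fun i => C (a i)) * X' * Matrix.diagonal (fun j => C (b j)) := by
    ext i j
    rw [AlgHom.mapMatrix_apply, Matrix.map_apply, Matrix.mul_diagonal, Matrix.diagonal_mul]
    simp only [hX', Matrix.mvPolynomialX_apply, linSubst_torusDiag_X, smul_eq_C_mul, map_mul]
    ring
  rw [hM, Matrix.det_mul, Matrix.det_mul, Matrix.det_diagonal, Matrix.det_diagonal, smul_eq_C_mul,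
    map_mul, map_prod, map_prod]
  ring

theorem isUnit_det_torusDiag {a b : ι → K} (ha : ∀ i, a i ≠ 0) (hb : ∀ j, b j ≠ 0) :
    IsUnit (torusDiag a b).det := by
  rw [torusDiag, Matrix.det_diagonal, isUnit_iff_ne_zero, Finset.prod_ne_zero_iff]
  intro p _
  exact mul_ne_zero (ha _) (hb _)

/-- **Torus stability of `Ann(det)`**: if `D ⌟ det = 0` then `(T·D) ⌟ det = 0` for every rank-one
diagonal scaling `T = diag(aᵢbⱼ)` with nonzero `a, b`. [folklore] -/
theorem apolarAction_torusDiag_detPoly {D : MvPolynomial (ι × ι) K}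
    (hD : apolarAction D (detPoly ι K) = 0) {a b : ι → K} (ha : ∀ i, a i ≠ 0) (hb : ∀ j, b j ≠ 0) :
    apolarAction (linSubst (ι × ι) K (torusDiag a b) D) (detPoly ι K) = 0 := by
  have h := apolarAction_linSubst_eq_zero_iff (torusDiag a b) (isUnit_det_torusDiag ha hb) D (detPoly ι K)
  rw [torusDiag_transpose] at h
  rw [← h, linSubst_torusDiag_detPoly, apolarAction_smul_right, hD, smul_zero]

end Torus

section Closed

variable {ι : Type*} [Fintype ι] [DecidableEq ι]

/-- A sum over the support of a degree-`j` form is a sum over all degree-`j` exponents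
(values in any additive commutative monoid). -/
theorem sum_support_eq_sum_deg' {A : Type*} [AddCommMonoid A] {j : ℕ} {D : MvPolynomial ι ℂ}
    (hD : D.IsHomogeneous j) (F : (ι →₀ ℕ) → A) (hF : ∀ d, coeff d D = 0 → F d = 0)
    [Fintype {d : ι →₀ ℕ // d.degree = j}] :
    ∑ d ∈ D.support, F d = ∑ d : {d : ι →₀ ℕ // d.degree = j}, F d.1 := by
  classical
  have hsub : D.support ⊆ (Finset.univ : Finset ι).finsuppAntidiag j := by
    intro d hd
    have : d.degree = j := by
      rw [Finsupp.degree_eq_weight_one]; exact hD (mem_support_iff.1 hd)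
    simp [Finset.mem_finsuppAntidiag, Finsupp.degree_eq_sum, ← this]
  rw [Finset.sum_subset hsub (fun d _ hd => hF d (notMem_support_iff.1 hd))]
  rw [← Finset.sum_subtype ((Finset.univ : Finset ι).finsuppAntidiag j)]
  intro d
  simp [Finset.mem_finsuppAntidiag, Finsupp.degree_eq_sum]

/-- A degree-`j` form is the sum of its degree-`j` terms over the finite type of exponents. -/
theorem eq_sum_deg {j : ℕ} {D : MvPolynomial ι ℂ} (hD : D.IsHomogeneous j) :
    D = ∑ d : {d : ι →₀ ℕ // d.degree = j}, monomial d.1 (coeff d.1 D) := by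
  conv_lhs => rw [as_sum D]
  exact sum_support_eq_sum_deg' hD (fun d => monomial d (coeff d D)) (fun d hd => by rw [hd, map_zero])

/-- **Coefficients of `D ⌟ f` are continuous linear in the coefficients of a degree-`j` form `D`**:
`(D ⌟ f)_u = Σ_{|e| = j} D_e · (xᵉ ⌟ f)_u`. [folklore] -/
theorem coeff_apolarAction_eq_sum_deg {j : ℕ} {D : MvPolynomial ι ℂ} (hD : D.IsHomogeneous j)
    (f : MvPolynomial ι ℂ) (u : ι →₀ ℕ) :
    coeff u (apolarAction D f) =
      ∑ e : {e : ι →₀ ℕ // e.degree = j}, coeff e.1 D * coeff u (apolarAction (monomial e.1 1) f) := by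
  conv_lhs => rw [eq_sum_deg hD]
  rw [apolarAction_sum_left, coeff_sum]
  refine Finset.sum_congr rfl fun e _ => ?_
  rw [show monomial e.1 (coeff e.1 D) = coeff e.1 D • monomial e.1 (1 : ℂ) by
    rw [smul_monomial, smul_eq_mul, mul_one], apolarAction_smul_left, coeff_smul, smul_eq_mul]

/-- **`Ann_j(f)` is closed under coefficientwise limits**: if forms `Ds t` of degree `j` annihilate
`f` and converge coefficientwise to `D`, then `D` is a form of degree `j` annihilating `f`.
(The W3 clause for a CONSTANT sequence.) [folklore] -/
theorem mem_annihilatorOfDegree_of_tendsto {j : ℕ} {f D : MvPolynomial ι ℂ} {Ds : ℕ → MvPolynomial ι ℂ}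
    (hDs : ∀ t, Ds t ∈ annihilatorOfDegree f j)
    (hlim : Tendsto (fun t => coeffVec (Ds t)) atTop (𝓝 (coeffVec D))) :
    D ∈ annihilatorOfDegree f j := by
  -- homogeneity of the limit
  have hhom : D.IsHomogeneous j := by
    have hcoeff : ∀ u : ι →₀ ℕ, u.degree ≠ j → coeff u D = 0 := by
      intro u hu
      have h1 : Tendsto (fun t => coeffVec (Ds t) u) atTop (𝓝 (coeffVec D u)) :=
        ((continuous_apply u).tendsto _).comp hlim
      have h2 : (fun t => coeffVec (Ds t) u) = fun _ => 0 := funext fun t => (hDs t).1.coeff_eq_zero hu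
      rw [h2] at h1
      exact tendsto_nhds_unique h1 tendsto_const_nhds
    intro u hu
    by_contra hne
    exact hu (hcoeff u (by rwa [Finsupp.degree_eq_weight_one]))
  refine ⟨hhom, ?_⟩
  -- each coefficient of `D ⌟ f` is the limit of the (zero) coefficients of `Ds t ⌟ f`
  ext u
  rw [coeff_zero, coeff_apolarAction_eq_sum_deg hhom]
  have hcont : Tendsto (fun t => ∑ e : {e : ι →₀ ℕ // e.degree = j},
      coeffVec (Ds t) e.1 * coeff u (apolarAction (monomial e.1 1) f)) atTop
      (𝓝 (∑ e : {e : ι →₀ ℕ // e.degree = j}, coeffVec D e.1 * coeff u (apolarAction (monomial e.1 1) f))) :=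
    tendsto_finsetSum _ fun e _ => (((continuous_apply e.1).tendsto _).comp hlim).mul tendsto_const_nhds
  have hzero : (fun t => ∑ e : {e : ι →₀ ℕ // e.degree = j},
      coeffVec (Ds t) e.1 * coeff u (apolarAction (monomial e.1 1) f)) = fun _ => 0 := by
    funext t
    have := congrArg (coeff u) (hDs t).2
    rw [coeff_apolarAction_eq_sum_deg (hDs t).1, coeff_zero] at this
    exact this
  rw [hzero] at hcont
  have := tendsto_nhds_unique tendsto_const_nhds hcont
  simpa only [coeffVec_apply] using this.symm

end Closed

end

end Summit.ValiantsHypothesis.ValiantsHypothesis.Cruxes.FixedWitnessObstructionQP.Disproof.Bilin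

/-! ## §10 W5 is ONE hyperplane condition (corollaries of §9 in crux vocabulary) -/

namespace Summit.ValiantsHypothesis.ValiantsHypothesis.Cruxes.FixedWitnessObstructionQP.Disproof

open Literature.Computability.AlgebraicComplexity
open Summit.ValiantsHypothesis.ValiantsHypothesis.Theses.BorderApolarity

set_option linter.dupNamespace false

/-- For a border limit (W2 ∧ W3), apolarity to `pp` in the top degree `m` already gives W5 in every
degree `≤ m`. [folklore] -/
theorem isApolarPP_of_top {n m : ℕ} [NeZero m] (hnm : n ≤ m) {P : ℕ → MvPolynomial (Fin m × Fin m) ℂ}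
    {J : ℕ → Set (MvPolynomial (Fin m × Fin m) ℂ)} (hLi : IsLiminf m P J) (hLs : IsLimsup m P J)
    (htop : ∀ D ∈ J m, apolarAction D (paddedPerPoly ℂ n m) = 0) : IsApolarPP n m J :=
  Bilin.apolar_all_of_top ((isLiminf_and_isLimsup_iff P J).1 ⟨hLi, hLs⟩)
    (paddedPerPoly_isHomogeneous hnm) htop

/-- **The witness notion with W5 only in degree `m` is equivalent** (for `n ≤ m`). [folklore] -/
theorem witnessExists_iff_top {n m : ℕ} [NeZero m] (hnm : n ≤ m) :
    WitnessExists n m ↔ ∃ (P : ℕ → MvPolynomial (Fin m × Fin m) ℂ)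
      (J : ℕ → Set (MvPolynomial (Fin m × Fin m) ℂ)), InOrbit m P ∧ IsLiminf m P J ∧ IsLimsup m P J ∧
        IsH0Stable n m J ∧ ∀ D ∈ J m, apolarAction D (paddedPerPoly ℂ n m) = 0 := by
  constructor
  · rintro ⟨P, J, h1, h2, h3, h4, h5⟩
    exact ⟨P, J, h1, h2, h3, h4, h5 m le_rfl⟩
  · rintro ⟨P, J, h1, h2, h3, h4, h5⟩
    exact ⟨P, J, h1, h2, h3, h4, isApolarPP_of_top hnm h2 h3 h5⟩

/-- **X restated with a single hyperplane condition**: beyond `n₀(c)`, for `m` in the window, no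
sequence in `GL·det_m` has an H₀(n,m)-stable Kuratowski limit `J` whose degree-`m` piece lies in the
hyperplane `(X₀₀^{m−n} per_n)^⊥_m`.  All lower-degree apolarity is automatic (§9). [folklore] -/
theorem crux_iff_top :
    FixedWitnessObstructionQP ↔
      ∀ c : ℕ, ∃ n₀ : ℕ, ∀ n ≥ n₀, ∀ (m : ℕ) [NeZero m], n ≤ m → m ≤ 2 ^ ((Nat.log 2 n + c) ^ c) →
        ¬ ∃ (P : ℕ → MvPolynomial (Fin m × Fin m) ℂ) (J : ℕ → Set (MvPolynomial (Fin m × Fin m) ℂ)),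
          InOrbit m P ∧ IsLiminf m P J ∧ IsLimsup m P J ∧ IsH0Stable n m J ∧
            ∀ D ∈ J m, apolarAction D (paddedPerPoly ℂ n m) = 0 := by
  rw [crux_iff]
  refine forall_congr' fun c => exists_congr fun n₀ => forall_congr' fun n => forall_congr' fun _ =>
    forall_congr' fun m => forall_congr' fun _ => forall_congr' fun hnm => forall_congr' fun _ => ?_
  rw [witnessExists_iff_top hnm]


/-- X with the H₀-stability clause W4 DROPPED from the witness notion (a STRONGER statement than X:
more witnesses are forbidden). -/
def CruxWithoutH0 : Prop :=
  ∀ c : ℕ, ∃ n₀ : ℕ, ∀ n ≥ n₀, ∀ (m : ℕ) [NeZero m], n ≤ m → m ≤ 2 ^ ((Nat.log 2 n + c) ^ c) →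
    ¬ ∃ (P : ℕ → MvPolynomial (Fin m × Fin m) ℂ) (J : ℕ → Set (MvPolynomial (Fin m × Fin m) ℂ)),
      InOrbit m P ∧ IsLiminf m P J ∧ IsLimsup m P J ∧ IsApolarPP n m J

/-- Dropping W4 strengthens X. [folklore] -/
theorem crux_of_cruxWithoutH0 (h : CruxWithoutH0) : FixedWitnessObstructionQP := by
  rw [crux_iff]
  intro c
  obtain ⟨n₀, hn₀⟩ := h c
  refine ⟨n₀, fun n hn m _ hnm hm ⟨P, J, h1, h2, h3, _, h5⟩ => hn₀ n hn m hnm hm ⟨P, J, h1, h2, h3, h5⟩⟩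

/-- **W4 (the H₀ normal form) is logically FREE**: even the W4-free strengthening of X follows from
the quasi-polynomial Mulmuley–Sohoni thesis, unconditionally (§7 uses neither W2 nor W4).  So
`GctWindow ⟹ CruxWithoutH0 ⟹ X ⟹ (Borel) GctWindow`: the normal form is a convenience a prover may
exploit, never an obstruction and never a weakening. [folklore] -/
theorem cruxWithoutH0_of_gctThesis (hG : GctWindow) : CruxWithoutH0 := by
  intro c
  obtain ⟨n₀, hn₀⟩ := hG c
  refine ⟨n₀, fun n hn m _ hnm hm ⟨P, J, h1, _, h3, h5⟩ => ?_⟩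
  exact hn₀ n hn m hnm hm (WTM.mem_orbitClosure_of_witness hnm P J h1 h3 h5)


/-! ## §11 W5 is load-bearing: with apolarity dropped, `(det_m, Ann(det_m))` is an H₀(m,m)-fixed junk witness -/

/-- X with the apolarity clause W5 dropped. -/
def CruxWithoutApolar : Prop :=
  ∀ c : ℕ, ∃ n₀ : ℕ, ∀ n ≥ n₀, ∀ (m : ℕ) [NeZero m], n ≤ m → m ≤ 2 ^ ((Nat.log 2 n + c) ^ c) →
    ¬ ∃ (P : ℕ → MvPolynomial (Fin m × Fin m) ℂ) (J : ℕ → Set (MvPolynomial (Fin m × Fin m) ℂ)),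
      InOrbit m P ∧ IsLiminf m P J ∧ IsLimsup m P J ∧ IsH0Stable n m J

/-- **At `n = m` the encoded group H₀(m,m) is the rank-one torus `{diag(aᵢbⱼ)}` and `Ann(det_m)` is
H₀(m,m)-stable** (torus semi-invariance of `det`, §9). [folklore] -/
theorem isH0Stable_ann_detPoly (m : ℕ) [NeZero m] :
    IsH0Stable m m (fun k => annihilatorOfDegree (detPoly (Fin m) ℂ) k) := by
  intro A M hrk hU hR1 _ k _ D hD
  -- `M` is diagonal
  have hdiag : ∀ i j : Fin m × Fin m, j ≠ i → M j i = 0 := fun i j hji =>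
    hU i j (Or.inl ⟨by simp, by simp⟩) hji
  have hMeq : M = Matrix.diagonal fun p => M p p := by
    ext j i
    by_cases h : j = i
    · subst h; rw [Matrix.diagonal_apply_eq]
    · rw [Matrix.diagonal_apply_ne _ h, hdiag i j h]
  -- diagonal entries are nonzero (A is invertible)
  have hdet : M.det ≠ 0 := by
    have : IsUnit M.det := by
      rw [show M = (A : Matrix (Fin m × Fin m) (Fin m × Fin m) ℂ) from rfl, ← Matrix.isUnit_iff_isUnit_det]
      exact Units.isUnit A
    exact this.ne_zero
  have hne : ∀ p : Fin m × Fin m, M p p ≠ 0 := by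
    rw [hMeq, Matrix.det_diagonal, Finset.prod_ne_zero_iff] at hdet
    intro p
    simpa using hdet p (Finset.mem_univ p)
  -- rank one: M_(i,j) = a_i b_j with a_i = M_(i,0), b_j = M_(0,j)/M_(0,0)
  set a : Fin m → ℂ := fun i => M (i, 0) (i, 0) with ha
  set b : Fin m → ℂ := fun j => M (0, j) (0, j) / M (0, 0) (0, 0) with hb
  have hab : ∀ i j : Fin m, M (i, j) (i, j) = a i * b j := by
    intro i j
    have h := hR1 i 0 j 0 (by simp) (by simp) (by simp) (by simp)
    rw [ha, hb]
    field_simp [hne (0, 0)]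
    linear_combination h
  have hMt : M = Bilin.torusDiag a b := by
    rw [hMeq, Bilin.torusDiag]
    congr 1
    funext p
    exact hab p.1 p.2
  have ha0 : ∀ i, a i ≠ 0 := fun i => hne (i, 0)
  have hb0 : ∀ j, b j ≠ 0 := fun j => div_ne_zero (hne (0, j)) (hne (0, 0))
  -- transport
  refine ⟨?_, ?_⟩
  · rw [hMt, Bilin.torusDiag_transpose]
    exact linSubst_isHomogeneous _ hD.1
  · rw [hMt, Bilin.torusDiag_transpose]
    exact Bilin.apolarAction_torusDiag_detPoly hD.2 ha0 hb0

/-- The constant sequence `det_m` with `J_k = Ann_k(det_m)` satisfies W1–W4 at `(m, m)`. [folklore] -/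
theorem junkWitness_det (m : ℕ) [NeZero m] :
    InOrbit m (fun _ => detPoly (Fin m) ℂ) ∧
    IsLiminf m (fun _ => detPoly (Fin m) ℂ) (fun k => annihilatorOfDegree (detPoly (Fin m) ℂ) k) ∧
    IsLimsup m (fun _ => detPoly (Fin m) ℂ) (fun k => annihilatorOfDegree (detPoly (Fin m) ℂ) k) ∧
    IsH0Stable m m (fun k => annihilatorOfDegree (detPoly (Fin m) ℂ) k) := by
  refine ⟨fun _ => mem_glOrbit_self _, ?_, ?_, isH0Stable_ann_detPoly m⟩
  · intro k _ D hD
    exact ⟨fun _ => D, fun _ => hD, tendsto_const_nhds⟩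
  · intro k _ D φ Ds _ hDs hlim
    exact Bilin.mem_annihilatorOfDegree_of_tendsto hDs hlim

/-- **W5 (apolarity) is load-bearing**: `CruxWithoutApolar` is FALSE (at `c = 1`, `m = n`, the pair
`(det_m, Ann det_m)` is an honest H₀-fixed border limit).  Together with §3: W1, W3, W5 are needed,
W2 and W4 are free (§8, §10). [folklore] -/
theorem false_without_apolar : ¬ CruxWithoutApolar := by
  intro h
  obtain ⟨n₀, hn₀⟩ := h 1
  have hn : max n₀ 1 ≥ n₀ := le_max_left _ _
  haveI : NeZero (max n₀ 1) := ⟨by omega⟩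
  refine hn₀ (max n₀ 1) hn (max n₀ 1) le_rfl ?_ ⟨_, _, junkWitness_det (max n₀ 1)⟩
  simp only [pow_one]
  exact le_of_lt (Nat.lt_pow_succ_log_self (by norm_num) _)

end Summit.ValiantsHypothesis.ValiantsHypothesis.Cruxes.FixedWitnessObstructionQP.Disproof
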